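import Literature.NumberTheory.LFunctions.DirichletExplicitRegionMidHeight
import Literature.NumberTheory.LFunctions.DirichletExplicitRegionSmallHeight
import HarnessLib

/-!
# McCurley's explicit region: zeros of height `|γ| ≤ 1` for characters of order 2, 3, 4 (§5), PROVED

Topic `Literature/NumberTheory/LFunctions` (namespace `Literature.NumberTheory.LFunctions.McCurleyStechkin`),
continuing `DirichletExplicitRegionMidHeight.lean` (orders `≥ 5`), `…SmallHeight.lean` (§6),
`…ComplexPoints.lean` (Lemma 7 core `fAtZeta_le`, `fAt_one_le`). Everything here is PROVED (standard
axioms); no definitions, NO named fact.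

Source: K. S. McCurley, *Explicit zero-free regions for Dirichlet L-functions*, J. Number Theory
**19** (1984) 7–32 [McCurley1984ZFR], **§5**, the cases of order 2, 3, 4 (pp. 26–27, (38)–(42)):
when a power `χᵐ` is principal, `f(mγ, χ₀)` is affected by the pole of `ζ` at `1`; Lemma 7 gives
`f(mt, χ₀) ≤ (σ−1)/((σ−1)² + m²t²) + d(2,m) − K log π + T(k,1)` (`0 ≤ t < 1`), and for
`γ ≥ c/log M` (`c = 0.538, 0.403, 0.264`) the pole term is at most `(r/(r² + m²c²)) log M ≤ aₘ⁻¹(…)K log M`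
with `σ = 1 + r/log M`, `r = 0.33901`; the principal corrections `aₘT(k,1) − a₀s(k)` are non-positive for
orders 3, 4 ((41)) and, for order 2, absorbed by `0.321 log M ≥ 0.321 Σ_{p∣k} log p` ((38): "the terms
of the sum are negative for `p > 11`").

## Main results (all for `χ` primitive mod `k`, `L ≥ log k`, `L ≥ log 10`, a zero `ρ = β + iγ`, `|γ| ≤ 1`)

* `order_three_mid_height`: `χ³ = χ₀`, `χ ≠ χ₀`, `0.403 ≤ |γ|·L` ⇒ `β < 1 − 1/(R L)` ((39)).
* `order_four_mid_height`: `χ⁴ = χ₀`, `χ² ≠ χ₀`, `0.264 ≤ |γ|·L` ⇒ `β < 1 − 1/(R L)` ((40)–(42)).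
* `order_two_mid_height`: `χ² = χ₀`, `χ ≠ χ₀`, `0.538 ≤ |γ|·L` ⇒ `β < 1 − 1/(R L)` ((38)).
* `order_four_low_height`: `χ⁴ = χ₀`, `χ² ≠ χ₀`, `|γ|·L ≤ 0.264` ⇒ `β < 1 − 1/(R L)` — McCurley's
  "intermediate range" argument (43)–(45) (`5 + 8cos θ + 4cos 2θ + cos 3θ ≥ 0` at complex points with the
  zero `ρ̄` of `L(s, χ̄)` kept in `f(3γ, χ̄)`), which covers the whole range `|γ| log M ≤ 0.264`.
* `height_le_one`: all of the above with `…SmallHeight.lean` (§6) and `…MidHeight.lean` (orders `≥ 5`):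
  for `χ` primitive, `χ ≠ χ₀`, every zero with `|γ| ≤ 1` (and `γ ≠ 0` if `χ` is real) has
  `β < 1 − 1/(R L)`. What remains of Theorem 1 is the case `|γ| > 1` (§4) and the count of real zeros
  of real characters (at most one; `…RealZeros.lean` has the window statement).

Supporting results: `fAt_principal_le_height` (Lemma 7 at `|t| ≤ T` with the digamma terms through the
Stirling sandwich — McCurley's `d(2,m)`: ours `0.180, 0.272, 0.369` for his `0.1565, 0.2638, 0.3636`),
`pole_le` (`(σ−1)/((σ−1)²+m²γ²) ≤ rL/(r²+m²c²)`), `uCorr_sigmaOne_le_div_sqrt_two`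
(`U(p,σ₁) ≤ U(p,σ)/√2`, since `σ₁ ≥ σ + ½`), `orderTwoPen_*` (the per-prime analysis of (38) with
`0.321 log p` absorbed: `≤ 4.86, 3.26, 1.78, 1.08, 0.31, 0.094` for `p = 2, 3, 5, 7, 11, 13`, `≤ 0` for
`p ≥ 17`; McCurley: negative for `p > 11`), `positivity_complex_poly3` ((27)/(44) at complex points for
any non-negative cubic cosine polynomial), `stF_diff_ge` (the kept zero at a shifted height, "as in (21)":
`F(s,ρ') − κF(s₁,ρ') ≥ Re (s−ρ')⁻¹ − 1`), `endgame_intermediate`.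

## References

* K. S. McCurley, J. Number Theory 19 (1984) 7–32, doi:10.1016/0022-314x(84)90089-1: Lemma 7
  (17)–(20), §5 (38)–(45) (pp. 26–29). [McCurley1984ZFR]
-/

noncomputable section

open Real Complex

namespace Literature.NumberTheory.LFunctions

namespace McCurleyStechkin

open Literature.Analysis.SpecialFunctions DirichletCharacter

/-! ## Elementary constants -/

/-- `log 3 ≤ 1.0986124`. [folklore] -/
private theorem log_three_le'' : Real.log 3 ≤ 1.0986124 := by
  rw [Real.log_le_iff_le_exp (by norm_num)]
  have h1 : Real.exp 1.0986124 = Real.exp 1 * Real.exp 0.0986124 := by rw [← Real.exp_add]; norm_num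
  have h2 : (1.1036384 : ℝ) ≤ Real.exp 0.0986124 := by
    have h := Real.sum_le_exp_of_nonneg (x := (0.0986124 : ℝ)) (by norm_num) 6
    refine le_trans ?_ h
    simp only [Finset.sum_range_succ, Finset.sum_range_zero, Nat.factorial]
    norm_num
  rw [h1]
  have he := Real.exp_one_gt_d9
  nlinarith

/-- `1.098612 ≤ log 3`. [folklore] -/
private theorem log_three_ge''' : (1.098612 : ℝ) ≤ Real.log 3 := by
  rw [Real.le_log_iff_exp_le (by norm_num)]
  have h1 : Real.exp 1.098612 = Real.exp 1 * Real.exp 0.098612 := by rw [← Real.exp_add]; norm_num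
  have h2 : Real.exp 0.098612 ≤ 1.1036381 := by
    have h := Real.exp_bound' (x := (0.098612 : ℝ)) (by norm_num) (by norm_num) (n := 5) (by norm_num)
    refine h.trans ?_
    simp only [Finset.sum_range_succ, Finset.sum_range_zero, Nat.factorial]
    norm_num
  rw [h1]
  have := Real.exp_one_lt_d9
  nlinarith [Real.exp_pos 0.098612]

/-- `1.609437 ≤ log 5`. [folklore] -/
private theorem log_five_ge''' : (1.609437 : ℝ) ≤ Real.log 5 := by
  rw [Real.le_log_iff_exp_le (by norm_num)]
  have h1 : Real.exp 1.609437 = Real.exp 1 * Real.exp 0.609437 := by rw [← Real.exp_add]; norm_num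
  have h2 : Real.exp 0.609437 ≤ 1.839396 := by
    have h := Real.exp_bound' (x := (0.609437 : ℝ)) (by norm_num) (by norm_num) (n := 7) (by norm_num)
    refine h.trans ?_
    simp only [Finset.sum_range_succ, Finset.sum_range_zero, Nat.factorial]
    norm_num
  rw [h1]
  have := Real.exp_one_lt_d9
  nlinarith [Real.exp_pos 0.609437]

/-- `log 5 ≤ 1.609438`. [folklore] -/
private theorem log_five_le' : Real.log 5 ≤ 1.609438 := by
  rw [Real.log_le_iff_le_exp (by norm_num)]
  have h1 : Real.exp 1.609438 = Real.exp 1 * Real.exp 0.609438 := by rw [← Real.exp_add]; norm_num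
  have h2 : (1.8393973 : ℝ) ≤ Real.exp 0.609438 := by
    have h := Real.sum_le_exp_of_nonneg (x := (0.609438 : ℝ)) (by norm_num) 9
    refine le_trans ?_ h
    simp only [Finset.sum_range_succ, Finset.sum_range_zero, Nat.factorial]
    norm_num
  rw [h1]
  have he := Real.exp_one_gt_d9
  nlinarith

/-- `1.1447 ≤ log π`. [folklore] -/
private theorem log_pi_ge''' : (1.1447 : ℝ) ≤ Real.log π := by
  rw [Real.le_log_iff_exp_le Real.pi_pos]
  have h1 : Real.exp 1.1447 = Real.exp 1 * Real.exp 0.1447 := by rw [← Real.exp_add]; norm_num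
  have h2 : Real.exp 0.1447 ≤ 1.1556934 := by
    have h := Real.exp_bound' (x := (0.1447 : ℝ)) (by norm_num) (by norm_num) (n := 5) (by norm_num)
    refine h.trans ?_
    simp only [Finset.sum_range_succ, Finset.sum_range_zero, Nat.factorial]
    norm_num
  rw [h1]
  have := Real.exp_one_lt_d9
  have := Real.pi_gt_d6
  nlinarith [Real.exp_pos 0.1447]

/-- `2/π² ≤ 0.20265`. [folklore] -/
private theorem two_div_pi_sq_le' : 2 / π ^ 2 ≤ 0.20265 := by
  have hπ := Real.pi_gt_d6
  have h : (3.141592 : ℝ) ^ 2 ≤ π ^ 2 := pow_le_pow_left₀ (by norm_num) hπ.le 2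
  rw [div_le_iff₀ (by positivity)]
  nlinarith

/-- `log 10 ≥ 2.30258`. [folklore] -/
private theorem log_ten_ge''' : (2.30258 : ℝ) ≤ Real.log 10 := by
  have h : Real.log 10 = Real.log 2 + Real.log 5 := by
    rw [show (10 : ℝ) = 2 * 5 by norm_num, Real.log_mul (by norm_num) (by norm_num)]
  rw [h]
  have h2 := Real.log_two_gt_d9
  have h5 := log_five_ge'''
  linarith

/-- `ψ(x) ≥ 0.2842` for `x ≥ 1.8` (`log(9/5) − 5/18 − 1/38.88`). [cite: McCurley1984ZFR, Lemma 1 (proof: "ψ(0.805 + a/2)", a = 2)] -/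
theorem re_digamma_ge_at_18 {x : ℝ} (hx : 1.8 ≤ x) : (0.2842 : ℝ) ≤ (Complex.digamma x).re := by
  have hx' : (9 : ℝ) / 5 ≤ x := by norm_num at hx ⊢; linarith
  have h1 := re_digamma_mono (x := (9 : ℝ) / 5) (by norm_num) hx'
  have h2 := Literature.Analysis.SpecialFunctions.Real.log_sub_le_re_digamma (x := (9 : ℝ) / 5) (by norm_num)
  have h3 : (0.587786 : ℝ) ≤ Real.log (9 / 5) := by
    rw [Real.log_div (by norm_num) (by norm_num), show (9 : ℝ) = 3 ^ 2 by norm_num, Real.log_pow]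
    have l3 := log_three_ge'''
    have l5 := log_five_le'
    push_cast
    linarith
  set y := (Complex.digamma (((9 : ℝ) / 5 : ℝ) : ℂ)).re with hy
  have h4 : Real.log (9 / 5) - 5 / 18 - 25 / 972 ≤ y := by
    have := h2; norm_num at this ⊢; linarith
  norm_num at h3 ⊢
  linarith

/-! ## The principal character at heights `|t| ≤ T` (Lemma 7 with Stirling) -/

/-- The Stirling bracket on a box `x ∈ [x₋, x₊]`. [cite: McCurley1984ZFR, Lemma 1 ((8))] -/
private theorem bracket_le' {x y xlo xhi LU : ℝ} (hxlo0 : 0 < xlo) (hxlo : xlo ≤ x) (hxhi : x ≤ xhi)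
    (hLU : Real.log (xhi ^ 2 + y ^ 2) ≤ LU) :
    Real.log (x ^ 2 + y ^ 2) / 2 - x / (2 * (x ^ 2 + y ^ 2)) + 2 / π ^ 2 / (x ^ 2 + y ^ 2) ≤
      LU / 2 - xlo / (2 * (xhi ^ 2 + y ^ 2)) + 0.20265 / (xlo ^ 2 + y ^ 2) := by
  have hx0 : 0 < x := by linarith
  have hUlo : xlo ^ 2 + y ^ 2 ≤ x ^ 2 + y ^ 2 := by nlinarith
  have hUhi : x ^ 2 + y ^ 2 ≤ xhi ^ 2 + y ^ 2 := by nlinarith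
  have hU0 : 0 < xlo ^ 2 + y ^ 2 := by positivity
  have h1 : Real.log (x ^ 2 + y ^ 2) ≤ LU := (Real.log_le_log (by positivity) hUhi).trans hLU
  have h2 : xlo / (2 * (xhi ^ 2 + y ^ 2)) ≤ x / (2 * (x ^ 2 + y ^ 2)) :=
    div_le_div₀ hx0.le hxlo (by positivity) (by linarith)
  have h3 : 2 / π ^ 2 / (x ^ 2 + y ^ 2) ≤ 0.20265 / (xlo ^ 2 + y ^ 2) :=
    div_le_div₀ (by norm_num) two_div_pi_sq_le' hU0 hUlo
  linarith

/-- **Lemma 7 at height `|t| ≤ T` (principal character mod `k`, `1 < σ ≤ 1.15`).** With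
`x = (σ+2)/2 ∈ [1.5, 1.575]`, `y = T/2` and an upper bound `cU` for the Stirling bracket at `(x, y)`:
`f(t, χ₀ mod k) ≤ (σ−1)/((σ−1)²+t²) − K log π + ½[cU − κ·0.2842] + Σ_{p∣k}[U(p,σ) + κU(p,σ₁)]`
(pole term of `ζ`; the `κ`-pole term is dropped; `Re ψ(s/2+1)` increases with `|t|`;
`Re ψ((σ₁+2)/2 + it/2) ≥ ψ((σ₁+2)/2) ≥ ψ(1.8)`). [cite: McCurley1984ZFR, Lemma 7 (17)–(20)] -/
theorem fAt_principal_le_height (k : ℕ) [NeZero k] {σ : ℝ} (hσ : 1 < σ) (hσ' : σ ≤ 1.15) {t T : ℝ}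
    (hT : |t| ≤ T) {cU : ℝ}
    (hcU : ∀ x : ℝ, 1.5 ≤ x → x ≤ 1.575 →
      Real.log (x ^ 2 + (T / 2) ^ 2) / 2 - x / (2 * (x ^ 2 + (T / 2) ^ 2)) + 2 / π ^ 2 / (x ^ 2 + (T / 2) ^ 2) ≤ cU) :
    fAt (1 : DirichletCharacter ℂ k) σ t ≤
      (σ - 1) / ((σ - 1) ^ 2 + t ^ 2) - bigK * Real.log π + (cU - kappa * 0.2842) / 2
        + ∑ p ∈ k.primeFactors, (uCorr p σ + kappa * uCorr p (sigmaOne σ)) := by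
  have h1 := fAt_one_le k hσ t
  have h2 := fAtZeta_le hσ t
  have hσ₁ := sigmaOne_gt_1618 hσ.le
  -- the pole terms
  have e1 : (1 / ((σ : ℂ) + t * I - 1)).re = (σ - 1) / ((σ - 1) ^ 2 + t ^ 2) := by
    rw [one_div, re_inv_sub_eq σ t 1, one_re, one_im, sub_zero]
  have e2 : (1 / ((sigmaOne σ : ℂ) + t * I - 1)).re =
      (sigmaOne σ - 1) / ((sigmaOne σ - 1) ^ 2 + t ^ 2) := by
    rw [one_div, re_inv_sub_eq (sigmaOne σ) t 1, one_re, one_im, sub_zero]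
  have hpole1 : 0 ≤ kappa * (1 / ((sigmaOne σ : ℂ) + t * I - 1)).re := by
    rw [e2]; exact mul_nonneg kappa_pos.le (div_nonneg (by linarith) (by positivity))
  -- the digamma terms
  have ex : ∀ u : ℝ, ((u : ℂ) + t * I) / 2 + 1 = (((u + 2) / 2 : ℝ) : ℂ) + ((t / 2 : ℝ) : ℂ) * I := by
    intro u; push_cast; ring
  rw [e1, ex σ, ex (sigmaOne σ)] at h2
  have hx0 : 0 < (σ + 2) / 2 := by linarith
  have hx1 : 0 < (sigmaOne σ + 2) / 2 := by linarith
  have hup1 : (Complex.digamma ((((σ + 2) / 2 : ℝ) : ℂ) + ((t / 2 : ℝ) : ℂ) * I)).re ≤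
      (Complex.digamma ((((σ + 2) / 2 : ℝ) : ℂ) + ((T / 2 : ℝ) : ℂ) * I)).re :=
    re_digamma_mono_abs_im hx0 (by rw [abs_div, abs_div, abs_two]; linarith [le_abs_self T])
  have hup2 := (abs_le.1 (abs_re_digamma_vertical_sub_le hx0 (T / 2))).2
  have hup3 := hcU ((σ + 2) / 2) (by linarith) (by linarith)
  have hlo1 : (Complex.digamma ((((sigmaOne σ + 2) / 2 : ℝ) : ℂ) + (((0 : ℝ)) : ℂ) * I)).re ≤
      (Complex.digamma ((((sigmaOne σ + 2) / 2 : ℝ) : ℂ) + ((t / 2 : ℝ) : ℂ) * I)).re :=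
    re_digamma_mono_abs_im hx1 (by rw [abs_zero]; exact abs_nonneg _)
  have e0 : ((((sigmaOne σ + 2) / 2 : ℝ) : ℂ) + (((0 : ℝ)) : ℂ) * I) = (((sigmaOne σ + 2) / 2 : ℝ) : ℂ) := by
    push_cast; ring
  rw [e0] at hlo1
  have hlo2 := re_digamma_ge_at_18 (x := (sigmaOne σ + 2) / 2) (by linarith)
  have hk := kappa_pos
  have hklo : kappa * 0.2842 ≤ kappa * (Complex.digamma ((((sigmaOne σ + 2) / 2 : ℝ) : ℂ) + ((t / 2 : ℝ) : ℂ) * I)).re :=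
    mul_le_mul_of_nonneg_left (hlo2.trans hlo1) hk.le
  linarith

/-- **Height `≤ 2`, principal**: `f(t, χ₀ mod k) ≤ (σ−1)/((σ−1)²+t²) − 0.136 + Σ_{p∣k}[U + κU₁]`
(`|t| ≤ 2`, `1 < σ ≤ 1.15`; McCurley `d(2,2) − K log π = −0.160`). [cite: McCurley1984ZFR, Lemma 7 and table d(2,2)] -/
theorem fAt_principal_le_height_two (k : ℕ) [NeZero k] {σ : ℝ} (hσ : 1 < σ) (hσ' : σ ≤ 1.15)
    {t : ℝ} (ht : |t| ≤ 2) :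
    fAt (1 : DirichletCharacter ℂ k) σ t ≤ (σ - 1) / ((σ - 1) ^ 2 + t ^ 2) - 0.136
      + ∑ p ∈ k.primeFactors, (uCorr p σ + kappa * uCorr p (sigmaOne σ)) := by
  have l2 := Real.log_two_lt_d9
  have l3 := log_three_le''
  have l5 := log_five_ge'''
  have hLU : Real.log ((1.575 : ℝ) ^ 2 + (2 / 2) ^ 2) ≤ 1.280935 := by
    have : Real.log ((1.575 : ℝ) ^ 2 + (2 / 2) ^ 2) ≤ Real.log (18 / 5) :=
      Real.log_le_log (by norm_num) (by norm_num)
    rw [Real.log_div (by norm_num) (by norm_num), show (18 : ℝ) = 3 ^ 2 * 2 by norm_num,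
      Real.log_mul (by norm_num) (by norm_num), Real.log_pow] at this
    push_cast at this
    linarith
  have h := fAt_principal_le_height k hσ hσ' ht (cU := 1.280935 / 2 - 1.5 / (2 * ((1.575 : ℝ) ^ 2 + (2 / 2) ^ 2))
    + 0.20265 / ((1.5 : ℝ) ^ 2 + (2 / 2) ^ 2))
    (fun x hx hx' ↦ bracket_le' (by norm_num) hx hx' hLU)
  have hlp := log_pi_ge'''
  have hK := bigK_gt
  have hk := kappa_gt
  norm_num at h ⊢
  nlinarith

/-- **Height `≤ 3`, principal**: `f(t, χ₀ mod k) ≤ (σ−1)/((σ−1)²+t²) − 0.044 + Σ_{p∣k}[U + κU₁]`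
(`|t| ≤ 3`; McCurley `d(2,3) − K log π = −0.053`). [cite: McCurley1984ZFR, Lemma 7 and table d(2,3)] -/
theorem fAt_principal_le_height_three (k : ℕ) [NeZero k] {σ : ℝ} (hσ : 1 < σ) (hσ' : σ ≤ 1.15)
    {t : ℝ} (ht : |t| ≤ 3) :
    fAt (1 : DirichletCharacter ℂ k) σ t ≤ (σ - 1) / ((σ - 1) ^ 2 + t ^ 2) - 0.044
      + ∑ p ∈ k.primeFactors, (uCorr p σ + kappa * uCorr p (sigmaOne σ)) := by
  have l2 := Real.log_two_lt_d9
  have l3 := log_three_le''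
  have l5 := log_five_ge'''
  have hLU : Real.log ((1.575 : ℝ) ^ 2 + (3 / 2) ^ 2) ≤ 1.568617 := by
    have : Real.log ((1.575 : ℝ) ^ 2 + (3 / 2) ^ 2) ≤ Real.log (24 / 5) :=
      Real.log_le_log (by norm_num) (by norm_num)
    rw [Real.log_div (by norm_num) (by norm_num), show (24 : ℝ) = 2 ^ 3 * 3 by norm_num,
      Real.log_mul (by norm_num) (by norm_num), Real.log_pow] at this
    push_cast at this
    linarith
  have h := fAt_principal_le_height k hσ hσ' ht (cU := 1.568617 / 2 - 1.5 / (2 * ((1.575 : ℝ) ^ 2 + (3 / 2) ^ 2))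
    + 0.20265 / ((1.5 : ℝ) ^ 2 + (3 / 2) ^ 2))
    (fun x hx hx' ↦ bracket_le' (by norm_num) hx hx' hLU)
  have hlp := log_pi_ge'''
  have hK := bigK_gt
  have hk := kappa_gt
  norm_num at h ⊢
  nlinarith

/-- **Height `≤ 4`, principal**: `f(t, χ₀ mod k) ≤ (σ−1)/((σ−1)²+t²) + 0.053 + Σ_{p∣k}[U + κU₁]`
(`|t| ≤ 4`; McCurley `d(2,4) − K log π = 0.047`). [cite: McCurley1984ZFR, Lemma 7 and table d(2,4)] -/
theorem fAt_principal_le_height_four (k : ℕ) [NeZero k] {σ : ℝ} (hσ : 1 < σ) (hσ' : σ ≤ 1.15)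
    {t : ℝ} (ht : |t| ≤ 4) :
    fAt (1 : DirichletCharacter ℂ k) σ t ≤ (σ - 1) / ((σ - 1) ^ 2 + t ^ 2) + 0.053
      + ∑ p ∈ k.primeFactors, (uCorr p σ + kappa * uCorr p (sigmaOne σ)) := by
  have l2 := Real.log_two_lt_d9
  have l3 := log_three_ge'''
  have l5 := log_five_le'
  have hLU : Real.log ((1.575 : ℝ) ^ 2 + (4 / 2) ^ 2) ≤ 1.897121 := by
    have : Real.log ((1.575 : ℝ) ^ 2 + (4 / 2) ^ 2) ≤ Real.log (20 / 3) :=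
      Real.log_le_log (by norm_num) (by norm_num)
    rw [Real.log_div (by norm_num) (by norm_num), show (20 : ℝ) = 2 ^ 2 * 5 by norm_num,
      Real.log_mul (by norm_num) (by norm_num), Real.log_pow] at this
    push_cast at this
    linarith
  have h := fAt_principal_le_height k hσ hσ' ht (cU := 1.897121 / 2 - 1.5 / (2 * ((1.575 : ℝ) ^ 2 + (4 / 2) ^ 2))
    + 0.20265 / ((1.5 : ℝ) ^ 2 + (4 / 2) ^ 2))
    (fun x hx hx' ↦ bracket_le' (by norm_num) hx hx' hLU)
  have hlp := log_pi_ge'''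
  have hK := bigK_gt
  have hk := kappa_gt
  norm_num at h ⊢
  nlinarith

/-! ## The pole term at `σ = 1 + r/L`, `|γ| ≥ c/L` -/

/-- **The pole term.** With `σ − 1 = r/L`, `|γ|·L ≥ c > 0`:
`(σ−1)/((σ−1)² + (mγ)²) ≤ (r/(r² + m²c²))·L` (any real `m`). [cite: McCurley1984ZFR, §5 (38)–(40)] -/
theorem pole_le {L r c γ m : ℝ} (hL : 0 < L) (hr : 0 < r) (hc : 0 < c) (hγ : c ≤ |γ| * L) :
    (r / L) / ((r / L) ^ 2 + (m * γ) ^ 2) ≤ r / (r ^ 2 + m ^ 2 * c ^ 2) * L := by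
  have hγ2 : (c / L) ^ 2 ≤ γ ^ 2 := by
    have h1 : c / L ≤ |γ| := by rw [div_le_iff₀ hL]; exact hγ
    have := pow_le_pow_left₀ (by positivity) h1 2
    rwa [sq_abs] at this
  have hden : (r / L) ^ 2 + m ^ 2 * (c / L) ^ 2 ≤ (r / L) ^ 2 + (m * γ) ^ 2 := by
    rw [mul_pow]; nlinarith [sq_nonneg m]
  have hpos : 0 < (r / L) ^ 2 + m ^ 2 * (c / L) ^ 2 := by positivity
  calc (r / L) / ((r / L) ^ 2 + (m * γ) ^ 2) ≤ (r / L) / ((r / L) ^ 2 + m ^ 2 * (c / L) ^ 2) :=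
        div_le_div_of_nonneg_left (by positivity) hpos hden
    _ = r / (r ^ 2 + m ^ 2 * c ^ 2) * L := by
        field_simp

/-! ## The principal corrections: `U(p,σ₁) ≤ U(p,σ)/√2` -/

/-- `σ₁ ≥ σ + ½` (`√(1+4σ²) ≥ 2σ`). [cite: McCurley1984ZFR, §2 (σ₁)] -/
theorem add_half_le_sigmaOne {σ : ℝ} (hσ : 0 ≤ σ) : σ + 1 / 2 ≤ sigmaOne σ := by
  unfold sigmaOne
  have h : 2 * σ ≤ Real.sqrt (1 + 4 * σ ^ 2) := by
    rw [show (2 * σ) = Real.sqrt ((2 * σ) ^ 2) by rw [Real.sqrt_sq (by linarith)]]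
    exact Real.sqrt_le_sqrt (by nlinarith)
  linarith

/-- **`U(p,σ₁) ≤ U(p,σ)/√2`** for `p ≥ 2`, `σ ≥ 1` (`σ₁ ≥ σ + ½`, `p^{σ+½} ≥ √2·p^σ`).
[cite: McCurley1984ZFR, §5 ((39), (41): "the terms of the sum are negative")] -/
theorem uCorr_sigmaOne_le_div_sqrt_two {p : ℕ} (hp : 2 ≤ p) {σ : ℝ} (hσ : 1 ≤ σ) :
    uCorr p (sigmaOne σ) ≤ uCorr p σ / Real.sqrt 2 := by
  have hp0 : (0 : ℝ) < p := by exact_mod_cast (show 0 < p by omega)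
  have hp1 : (1 : ℝ) < p := by exact_mod_cast hp
  have hp2 : (2 : ℝ) ≤ p := by exact_mod_cast hp
  have hlog : 0 ≤ Real.log p := Real.log_nonneg hp1.le
  have h2 : 0 < Real.sqrt 2 := Real.sqrt_pos.2 (by norm_num)
  have hs2 : 1 < Real.sqrt 2 := by
    rw [show (1 : ℝ) = Real.sqrt 1 by simp]; exact Real.sqrt_lt_sqrt (by norm_num) (by norm_num)
  -- `U(p, σ₁) ≤ U(p, σ + ½)`
  have h1 : uCorr p (sigmaOne σ) ≤ uCorr p (σ + 1 / 2) :=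
    uCorr_anti hp (by linarith) (add_half_le_sigmaOne (by linarith))
  refine h1.trans ?_
  -- closed forms
  have hU : ∀ {t : ℝ}, 0 < t → uCorr p t = Real.log p / ((p : ℝ) ^ t - 1) := by
    intro t ht
    have hpt : 1 < (p : ℝ) ^ t := Real.one_lt_rpow hp1 ht
    unfold uCorr
    rw [Real.rpow_neg hp0.le]
    field_simp
  rw [hU (by linarith), hU (by linarith)]
  have hpσ : (2 : ℝ) ≤ (p : ℝ) ^ σ := by
    calc (2 : ℝ) ≤ p := hp2
      _ = (p : ℝ) ^ (1 : ℝ) := (Real.rpow_one _).symm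
      _ ≤ (p : ℝ) ^ σ := Real.rpow_le_rpow_of_exponent_le hp1.le hσ
  have hsp : Real.sqrt 2 ≤ Real.sqrt p := Real.sqrt_le_sqrt hp2
  have hsplit : (p : ℝ) ^ (σ + 1 / 2) = (p : ℝ) ^ σ * Real.sqrt p := by
    rw [Real.rpow_add hp0, Real.sqrt_eq_rpow]
  rw [hsplit]
  -- `log p/(p^σ √p − 1) ≤ (log p/(p^σ − 1))/√2` ⇔ `√2 (p^σ − 1) ≤ p^σ √p − 1`
  have hd1 : 0 < (p : ℝ) ^ σ - 1 := by linarith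
  have hd2 : 0 < (p : ℝ) ^ σ * Real.sqrt p - 1 := by nlinarith
  rw [div_div, div_le_div_iff₀ hd2 (by positivity)]
  have : Real.sqrt 2 * ((p : ℝ) ^ σ - 1) ≤ (p : ℝ) ^ σ * Real.sqrt p - 1 := by nlinarith
  nlinarith

/-! ## §5: the clauses for orders 3 and 4 -/

section Clauses

variable {k : ℕ} [NeZero k] {χ : DirichletCharacter ℂ k}

omit [NeZero k] in
/-- `χ⁻¹` is primitive when `χ` is. [cite: MontgomeryVaughan2007, §10.1 p. 334] -/
private theorem isPrimitive_inv'' (hχ : χ.IsPrimitive) : χ⁻¹.IsPrimitive := by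
  rw [DirichletCharacter.isPrimitive_def, DirichletCharacter.conductor_inv]; exact hχ

/-- `s_k(σ) ≥ 0`. [cite: McCurley1984ZFR, §2 ("s(k) > 0")] -/
private theorem sum_help_nonneg'' (k : ℕ) {σ : ℝ} (hσ : 1 < σ) :
    0 ≤ ∑ p ∈ k.primeFactors, (uCorr p σ - kappa * uCorr p (sigmaOne σ)) :=
  Finset.sum_nonneg fun _ hp ↦ help_nonneg (Nat.prime_of_mem_primeFactors hp).two_le hσ

/-- The order-3 principal correction is non-positive: `(a₃ − a₀)U + (a₃ + a₀)κU₁ ≤ 0`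
(`U₁ ≤ U/√2`). [cite: McCurley1984ZFR, §5 (39) ("since the terms of the sum are negative")] -/
private theorem orderThree_corr_nonpos (k : ℕ) {σ : ℝ} (hσ : 1 < σ) :
    rsA3 * ∑ p ∈ k.primeFactors, (uCorr p σ + kappa * uCorr p (sigmaOne σ))
      - rsA0 * ∑ p ∈ k.primeFactors, (uCorr p σ - kappa * uCorr p (sigmaOne σ)) ≤ 0 := by
  rw [Finset.mul_sum, Finset.mul_sum, ← Finset.sum_sub_distrib]
  refine Finset.sum_nonpos fun p hp ↦ ?_
  have hp2 := (Nat.prime_of_mem_primeFactors hp).two_le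
  have hU1 := uCorr_sigmaOne_le_div_sqrt_two hp2 hσ.le
  have hU0 : 0 ≤ uCorr p σ := uCorr_nonneg hp2 (by linarith)
  have hU10 : 0 ≤ uCorr p (sigmaOne σ) := uCorr_nonneg hp2 (by linarith [one_lt_sigmaOne hσ.le])
  have hs : (1.41421 : ℝ) < Real.sqrt 2 := by
    rw [show (1.41421 : ℝ) = Real.sqrt (1.41421 ^ 2) by rw [Real.sqrt_sq (by norm_num)]]
    exact Real.sqrt_lt_sqrt (by norm_num) (by norm_num)
  have hU1' : uCorr p (sigmaOne σ) * 1.41421 ≤ uCorr p σ := by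
    have h := (le_div_iff₀ (by linarith : (0:ℝ) < Real.sqrt 2)).1 hU1
    nlinarith
  have hk := kappa_lt
  simp only [rsA3, rsA0]
  nlinarith [mul_le_mul_of_nonneg_right hk.le hU10]

/-- Common bookkeeping: `σ = 1 + r/L` with `r = rOpt`, `L ≥ log 10`. [cite: McCurley1984ZFR, §5] -/
private theorem setup' {L : ℝ} (hL10 : Real.log 10 ≤ L) {β : ℝ} (hβ : 1 - 1 / (9.645908801 * L) ≤ β) :
    0 < L ∧ 2.30258 ≤ L ∧ 1 < 1 + rOpt / L ∧ 1 + rOpt / L ≤ 1.15 ∧ 0 < β ∧ β ≠ 1 / 2 ∧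
      1 - (1 / 9.645908801) / L ≤ β ∧ 1 + rOpt / L - 1 = rOpt / L := by
  have hL : 2.30258 ≤ L := log_ten_ge'''.trans hL10
  have hL0 : 0 < L := by linarith
  have hr : (0 : ℝ) < rOpt := by norm_num [rOpt]
  have hb : 1 - (1 / 9.645908801) / L ≤ β := by
    have e : 1 / (9.645908801 * L) = (1 / 9.645908801) / L := by rw [div_div]
    rw [← e]; exact hβ
  have hbL : (1 / 9.645908801) / L ≤ 0.0451 := by
    rw [div_le_iff₀ hL0]; norm_num; linarith
  refine ⟨hL0, hL, by have := div_pos hr hL0; linarith, ?_, by linarith, ?_, hb, by ring⟩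
  · have : rOpt / L ≤ 0.15 := by rw [div_le_iff₀ hL0]; norm_num [rOpt]; linarith
    linarith
  · intro h; rw [h] at hb; linarith

/-- **McCurley's Theorem 1, §5 clause for cubic characters.** Let `χ` be a primitive character mod
`k` with `χ³ = χ₀`, `χ ≠ χ₀`, `L ≥ log k`, `L ≥ log 10`, and `ρ = β + iγ` a zero of `L(s, χ)` with
`0.403 ≤ |γ|·L` and `|γ| ≤ 1`. Then `β < 1 − 1/(R L)`, `R = 9.645908801` ((39): `χ² = χ̄` and `χ⁴ = χ`
are primitive, `χ³ = χ₀` carries the pole term `a₃(σ−1)/((σ−1)² + 9γ²) ≤ a₃ K log M`, and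
`a₃T(k,1) − a₀s(k) ≤ 0`). [cite: McCurley1984ZFR, §5 (39) and Theorem 1] -/
theorem order_three_mid_height (hχ : χ.IsPrimitive) (h1 : χ ≠ 1) (h3 : χ ^ 3 = 1) {L : ℝ}
    (hLk : Real.log k ≤ L) (hL10 : Real.log 10 ≤ L) {ρ : ℂ} (hz : χ.LFunction ρ = 0)
    (hγlo : 0.403 ≤ |ρ.im| * L) (hγ : |ρ.im| ≤ 1) :
    ρ.re < 1 - 1 / (9.645908801 * L) := by
  by_contra hcon
  have hβw := not_lt.1 hcon
  obtain ⟨hL0, hL, hσ, hσ', hβ0, hβh, hβ', hσm1⟩ := setup' hL10 hβw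
  set σ := 1 + rOpt / L with hσdef
  have hr : (0 : ℝ) < rOpt := by norm_num [rOpt]
  -- the powers: `χ² = χ⁻¹`, `χ⁴ = χ`
  have hinv : χ ^ 2 = χ⁻¹ := by
    have : χ ^ 2 * χ = 1 := by rw [← pow_succ]; exact h3
    exact eq_inv_of_mul_eq_one_left this
  have h4 : χ ^ 4 = χ := by rw [pow_succ, h3, one_mul]
  -- positivity (27) at height γ
  have hP := rosser_positivity_complex χ hσ ρ.im
  rw [hinv, h3, h4] at hP
  -- the five indices
  have hζ := fdiff_principal_le_sharp115 (k := k) hσ hσ'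
  have hm1 := DirichletTheta.fAt_le_of_zero_im hχ h1 hσ.le hz hβ0 hβh
  have hm2 := DirichletTheta.fAt_le (isPrimitive_inv'' hχ) (inv_ne_one.2 h1) hσ.le (2 * ρ.im)
  rw [DirichletTheta.charParity_inv] at hm2
  have hm3 := fAt_principal_le_height_three k hσ hσ' (t := 3 * ρ.im)
    (by rw [abs_mul, abs_of_pos (by norm_num : (0:ℝ) < 3)]; linarith)
  have hm4 := DirichletTheta.fAt_le hχ h1 hσ.le (4 * ρ.im)
  have hΓ1 := gammaDiff_le_height_one (charParity_le_one χ) hσ hσ' hγ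
  have hΓ2 := gammaDiff_le_height_two (charParity_le_one χ) hσ hσ' (t := 2 * ρ.im)
    (by rw [abs_mul, abs_two]; linarith)
  have hΓ4 := gammaDiff_le_height_four (charParity_le_one χ) hσ hσ' (t := 4 * ρ.im)
    (by rw [abs_mul, abs_of_pos (by norm_num : (0:ℝ) < 4)]; linarith)
  -- the pole term
  have hpole := pole_le (m := 3) hL0 hr (by norm_num : (0:ℝ) < 0.403) hγlo
  rw [← hσm1] at hpole
  have hpc : rOpt / (rOpt ^ 2 + 3 ^ 2 * 0.403 ^ 2) ≤ bigK := by
    have hK := bigK_gt; norm_num [rOpt] at hK ⊢; linarith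
  have hpole' : (σ - 1) / ((σ - 1) ^ 2 + (3 * ρ.im) ^ 2) ≤ bigK * L :=
    hpole.trans (mul_le_mul_of_nonneg_right hpc hL0.le)
  -- the corrections
  have hcorr := orderThree_corr_nonpos k hσ
  have hKpos := bigK_pos
  have hKL : bigK * Real.log k ≤ bigK * L := mul_le_mul_of_nonneg_left hLk hKpos.le
  have a0 : (0 : ℝ) ≤ rsA0 := by norm_num [rsA0]
  have a1 : (0 : ℝ) ≤ rsA1 := by norm_num [rsA1]
  have a2 : (0 : ℝ) ≤ rsA2 := by norm_num [rsA2]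
  have a3 : (0 : ℝ) ≤ rsA3 := by norm_num [rsA3]
  have a4 : (0 : ℝ) ≤ rsA4 := by norm_num [rsA4]
  have e0 := mul_le_mul_of_nonneg_left hζ a0
  have e1 := mul_le_mul_of_nonneg_left (show fAt χ σ ρ.im ≤ bigK * L - 0.237 - 1 / (σ - ρ.re) by
    linarith) a1
  have e2 := mul_le_mul_of_nonneg_left (show fAt χ⁻¹ σ (2 * ρ.im) ≤ bigK * L - 0.038 by linarith) a2
  have e3 := mul_le_mul_of_nonneg_left (show fAt (1 : DirichletCharacter ℂ k) σ (3 * ρ.im) ≤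
    bigK * L - 0.044 + ∑ p ∈ k.primeFactors, (uCorr p σ + kappa * uCorr p (sigmaOne σ)) by linarith) a3
  have e4 := mul_le_mul_of_nonneg_left (show fAt χ σ (4 * ρ.im) ≤ bigK * L + 0.274 by linarith) a4
  have hc : -(0.80 : ℝ) * rsA0 - 0.237 * rsA1 - 0.038 * rsA2 - 0.044 * rsA3 + 0.274 * rsA4 ≤ -13 := by
    norm_num [rsA0, rsA1, rsA2, rsA3, rsA4]
  have key : rsA1 * (1 / (σ - ρ.re)) ≤ rsA0 * (1 / (σ - 1))
      + bigK * (rsA1 + rsA2 + rsA3 + rsA4) * L - 13 := by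
    linarith [e0, e1, e2, e3, e4, hP, hcorr, hc]
  have hm : rsA1 / (σ - ρ.re) ≤ rsA0 / (σ - 1) + bigK * (rsA1 + rsA2 + rsA3 + rsA4) * L - 13 := by
    simpa only [mul_one_div] using key
  have hβ1 : ρ.re < 1 := by
    by_contra hb
    exact LFunction_ne_zero_of_one_le_re χ (Or.inl h1) (not_lt.1 hb) hz
  have hc1 : (0 : ℝ) < rsA1 := by norm_num [rsA1]
  refine endgame_contra (K' := bigK * (rsA1 + rsA2 + rsA3 + rsA4)) (C := -13) hL0 hr (by norm_num) hc1
    (by norm_num) hβ' (by linarith) ?_ numeric_generic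
  linarith

/-- **McCurley's Theorem 1, §5 clause for quartic characters.** Let `χ` be a primitive character mod
`k` with `χ⁴ = χ₀`, `χ² ≠ χ₀`, `L ≥ log k`, `L ≥ log 10`, and `ρ = β + iγ` a zero of `L(s, χ)` with
`0.264 ≤ |γ|·L` and `|γ| ≤ 1`. Then `β < 1 − 1/(R L)` ((40)–(42): `χ³ = χ̄` primitive, `χ²` real
possibly imprimitive with `T(k,k₂) − K log(k/k₂) < 1.012` (ours `1.07`), `χ⁴ = χ₀` with the pole term
`≤ a₄K log M` and `a₄T(k,1) − a₀s(k) ≤ 0`). [cite: McCurley1984ZFR, §5 (40)–(42) and Theorem 1] -/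
theorem order_four_mid_height (hχ : χ.IsPrimitive) (h2 : χ ^ 2 ≠ 1) (h4 : χ ^ 4 = 1) {L : ℝ}
    (hLk : Real.log k ≤ L) (hL10 : Real.log 10 ≤ L) {ρ : ℂ} (hz : χ.LFunction ρ = 0)
    (hγlo : 0.264 ≤ |ρ.im| * L) (hγ : |ρ.im| ≤ 1) :
    ρ.re < 1 - 1 / (9.645908801 * L) := by
  by_contra hcon
  have hβw := not_lt.1 hcon
  have h1 : χ ≠ 1 := fun h ↦ h2 (by rw [h, one_pow])
  obtain ⟨hL0, hL, hσ, hσ', hβ0, hβh, hβ', hσm1⟩ := setup' hL10 hβw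
  set σ := 1 + rOpt / L with hσdef
  have hr : (0 : ℝ) < rOpt := by norm_num [rOpt]
  -- the powers: `χ³ = χ⁻¹`
  have hinv : χ ^ 3 = χ⁻¹ := by
    have : χ ^ 3 * χ = 1 := by rw [← pow_succ]; exact h4
    exact eq_inv_of_mul_eq_one_left this
  have hP := rosser_positivity_complex χ hσ ρ.im
  rw [hinv, h4] at hP
  have hζ := fdiff_principal_le_sharp115 (k := k) hσ hσ'
  have hm1 := DirichletTheta.fAt_le_of_zero_im hχ h1 hσ.le hz hβ0 hβh
  have hm2 := fAt_induced_le (χ ^ 2) h2 hσ (2 * ρ.im)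
  have hG := sum_max_gPen_le k hσ
  have hm3 := DirichletTheta.fAt_le (isPrimitive_inv'' hχ) (inv_ne_one.2 h1) hσ.le (3 * ρ.im)
  rw [DirichletTheta.charParity_inv] at hm3
  have hm4 := fAt_principal_le_height_four k hσ hσ' (t := 4 * ρ.im)
    (by rw [abs_mul, abs_of_pos (by norm_num : (0:ℝ) < 4)]; linarith)
  have hΓ1 := gammaDiff_le_height_one (charParity_le_one χ) hσ hσ' hγ
  have hΓ2 := gammaDiff_le_height_two (charParity_le_one (χ ^ 2)) hσ hσ' (t := 2 * ρ.im)
    (by rw [abs_mul, abs_two]; linarith)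
  have hΓ3 := gammaDiff_le_height_three (charParity_le_one χ) hσ hσ' (t := 3 * ρ.im)
    (by rw [abs_mul, abs_of_pos (by norm_num : (0:ℝ) < 3)]; linarith)
  -- the pole term
  have hpole := pole_le (m := 4) hL0 hr (by norm_num : (0:ℝ) < 0.264) hγlo
  rw [← hσm1] at hpole
  have hpc : rOpt / (rOpt ^ 2 + 4 ^ 2 * 0.264 ^ 2) ≤ bigK := by
    have hK := bigK_gt; norm_num [rOpt] at hK ⊢; linarith
  have hpole' : (σ - 1) / ((σ - 1) ^ 2 + (4 * ρ.im) ^ 2) ≤ bigK * L :=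
    hpole.trans (mul_le_mul_of_nonneg_right hpc hL0.le)
  -- the corrections: `a₄(U + κU₁) − a₀(U − κU₁) ≤ 0`
  have hcorr : rsA4 * ∑ p ∈ k.primeFactors, (uCorr p σ + kappa * uCorr p (sigmaOne σ))
      - rsA0 * ∑ p ∈ k.primeFactors, (uCorr p σ - kappa * uCorr p (sigmaOne σ)) ≤ 0 := by
    rw [Finset.mul_sum, Finset.mul_sum, ← Finset.sum_sub_distrib]
    refine Finset.sum_nonpos fun p hp ↦ ?_
    have hp2 := (Nat.prime_of_mem_primeFactors hp).two_le
    have hU1 : uCorr p (sigmaOne σ) ≤ uCorr p σ :=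
      uCorr_anti hp2 (by linarith) (lt_sigmaOne (show (0:ℝ) < σ by linarith)).le
    have hU10 : 0 ≤ uCorr p (sigmaOne σ) := uCorr_nonneg hp2 (by linarith [one_lt_sigmaOne hσ.le])
    have hU0 : 0 ≤ uCorr p σ := uCorr_nonneg hp2 (by linarith)
    have hk1 : kappa * uCorr p (sigmaOne σ) ≤ kappa * uCorr p σ :=
      mul_le_mul_of_nonneg_left hU1 kappa_pos.le
    have hk2 : kappa * uCorr p σ ≤ 0.44723 * uCorr p σ :=
      mul_le_mul_of_nonneg_right kappa_lt.le hU0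
    have hk3 : 0 ≤ kappa * uCorr p (sigmaOne σ) := mul_nonneg kappa_pos.le hU10
    simp only [rsA4, rsA0]
    linarith
  have hKpos := bigK_pos
  have hKL : bigK * Real.log k ≤ bigK * L := mul_le_mul_of_nonneg_left hLk hKpos.le
  have a0 : (0 : ℝ) ≤ rsA0 := by norm_num [rsA0]
  have a1 : (0 : ℝ) ≤ rsA1 := by norm_num [rsA1]
  have a2 : (0 : ℝ) ≤ rsA2 := by norm_num [rsA2]
  have a3 : (0 : ℝ) ≤ rsA3 := by norm_num [rsA3]
  have a4 : (0 : ℝ) ≤ rsA4 := by norm_num [rsA4]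
  have e0 := mul_le_mul_of_nonneg_left hζ a0
  have e1 := mul_le_mul_of_nonneg_left (show fAt χ σ ρ.im ≤ bigK * L - 0.237 - 1 / (σ - ρ.re) by
    linarith) a1
  have e2 := mul_le_mul_of_nonneg_left (show fAt (χ ^ 2) σ (2 * ρ.im) ≤ bigK * L - 0.038 + 1.07 by
    linarith) a2
  have e3 := mul_le_mul_of_nonneg_left (show fAt χ⁻¹ σ (3 * ρ.im) ≤ bigK * L + 0.141 by linarith) a3
  have e4 := mul_le_mul_of_nonneg_left (show fAt (1 : DirichletCharacter ℂ k) σ (4 * ρ.im) ≤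
    bigK * L + 0.053 + ∑ p ∈ k.primeFactors, (uCorr p σ + kappa * uCorr p (sigmaOne σ)) by linarith) a4
  have hc : -(0.80 : ℝ) * rsA0 - 0.237 * rsA1 + (1.07 - 0.038) * rsA2 + 0.141 * rsA3 + 0.053 * rsA4 ≤ -0.69 := by
    norm_num [rsA0, rsA1, rsA2, rsA3, rsA4]
  have key : rsA1 * (1 / (σ - ρ.re)) ≤ rsA0 * (1 / (σ - 1))
      + bigK * (rsA1 + rsA2 + rsA3 + rsA4) * L - 0.69 := by
    linarith [e0, e1, e2, e3, e4, hP, hcorr, hc]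
  have hm : rsA1 / (σ - ρ.re) ≤ rsA0 / (σ - 1) + bigK * (rsA1 + rsA2 + rsA3 + rsA4) * L - 0.69 := by
    simpa only [mul_one_div] using key
  have hβ1 : ρ.re < 1 := by
    by_contra hb
    exact LFunction_ne_zero_of_one_le_re χ (Or.inl h1) (not_lt.1 hb) hz
  have hc1 : (0 : ℝ) < rsA1 := by norm_num [rsA1]
  refine endgame_contra (K' := bigK * (rsA1 + rsA2 + rsA3 + rsA4)) (C := -0.69) hL0 hr (by norm_num) hc1
    (by norm_num) hβ' (by linarith) ?_ numeric_generic
  linarith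

end Clauses

/-! ## §5: the clause for real characters ((38)) -/

/-- `log 7 ≤ 2`, `log 11 ≤ 2.4`, `log 13 ≤ 2.6`. [folklore] -/
private theorem log_bounds_7_11_13 :
    Real.log 7 ≤ 2 ∧ Real.log 11 ≤ 2.4 ∧ Real.log 13 ≤ 2.6 := by
  have he := Real.exp_one_gt_d9
  have h2 : Real.exp 2 = Real.exp 1 * Real.exp 1 := by rw [← Real.exp_add]; norm_num
  refine ⟨?_, ?_, ?_⟩
  · rw [Real.log_le_iff_le_exp (by norm_num), h2]; nlinarith
  · rw [Real.log_le_iff_le_exp (by norm_num)]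
    have h1 : Real.exp 2.4 = Real.exp 1 * Real.exp 1 * Real.exp 0.4 := by
      rw [← Real.exp_add, ← Real.exp_add]; norm_num
    have h3 : (1.4918 : ℝ) ≤ Real.exp 0.4 := by
      have h := Real.sum_le_exp_of_nonneg (x := (0.4 : ℝ)) (by norm_num) 6
      refine le_trans ?_ h
      simp only [Finset.sum_range_succ, Finset.sum_range_zero, Nat.factorial]
      norm_num
    rw [h1]; nlinarith
  · rw [Real.log_le_iff_le_exp (by norm_num)]
    have h1 : Real.exp 2.6 = Real.exp 1 * Real.exp 1 * Real.exp 0.6 := by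
      rw [← Real.exp_add, ← Real.exp_add]; norm_num
    have h3 : (1.822 : ℝ) ≤ Real.exp 0.6 := by
      have h := Real.sum_le_exp_of_nonneg (x := (0.6 : ℝ)) (by norm_num) 6
      refine le_trans ?_ h
      simp only [Finset.sum_range_succ, Finset.sum_range_zero, Nat.factorial]
      norm_num
    rw [h1]; nlinarith

/-- `1.41421 < √2`, `1.73205 < √3`, `2.236 < √5`, `2.6457 < √7`, `3.3166 < √11`, `3.6055 < √13`,
`4.1231 < √17`. [folklore] -/
private theorem sqrt_lower_bounds'' :
    (1.41421 : ℝ) < Real.sqrt 2 ∧ (1.73205 : ℝ) < Real.sqrt 3 ∧ (2.236 : ℝ) < Real.sqrt 5 ∧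
      (2.6457 : ℝ) < Real.sqrt 7 ∧ (3.3166 : ℝ) < Real.sqrt 11 ∧ (3.6055 : ℝ) < Real.sqrt 13 ∧
      (4.1231 : ℝ) < Real.sqrt 17 := by
  refine ⟨?_, ?_, ?_, ?_, ?_, ?_, ?_⟩
  · rw [show (1.41421 : ℝ) = Real.sqrt (1.41421 ^ 2) by rw [Real.sqrt_sq (by norm_num)]]
    exact Real.sqrt_lt_sqrt (by norm_num) (by norm_num)
  · rw [show (1.73205 : ℝ) = Real.sqrt (1.73205 ^ 2) by rw [Real.sqrt_sq (by norm_num)]]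
    exact Real.sqrt_lt_sqrt (by norm_num) (by norm_num)
  · rw [show (2.236 : ℝ) = Real.sqrt (2.236 ^ 2) by rw [Real.sqrt_sq (by norm_num)]]
    exact Real.sqrt_lt_sqrt (by norm_num) (by norm_num)
  · rw [show (2.6457 : ℝ) = Real.sqrt (2.6457 ^ 2) by rw [Real.sqrt_sq (by norm_num)]]
    exact Real.sqrt_lt_sqrt (by norm_num) (by norm_num)
  · rw [show (3.3166 : ℝ) = Real.sqrt (3.3166 ^ 2) by rw [Real.sqrt_sq (by norm_num)]]
    exact Real.sqrt_lt_sqrt (by norm_num) (by norm_num)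
  · rw [show (3.6055 : ℝ) = Real.sqrt (3.6055 ^ 2) by rw [Real.sqrt_sq (by norm_num)]]
    exact Real.sqrt_lt_sqrt (by norm_num) (by norm_num)
  · rw [show (4.1231 : ℝ) = Real.sqrt (4.1231 ^ 2) by rw [Real.sqrt_sq (by norm_num)]]
    exact Real.sqrt_lt_sqrt (by norm_num) (by norm_num)

/-- **The per-prime term of (38)** with `0.321 log p` absorbed: for `p` prime, `σ > 1`, `log p ≤ A`,
`s ≤ √p`, `ps > 1`:
`(a₂+a₄)[U + κU₁] − a₀[U − κU₁] − 0.321 log p ≤ max(A·B, 0)`,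
`B = (a₂+a₄−a₀)/(p−1) + 0.44723(a₂+a₄+a₀)/(ps−1) − 0.321`. [cite: McCurley1984ZFR, §5 (38)] -/
private theorem orderTwoPen_le_of {p : ℕ} (hp : 2 ≤ p) {σ : ℝ} (hσ : 1 < σ) {A s : ℝ}
    (hA : Real.log p ≤ A) (hs : s ≤ Real.sqrt p) (hs1 : 1 < (p : ℝ) * s) :
    (rsA2 + rsA4) * (uCorr p σ + kappa * uCorr p (sigmaOne σ))
        - rsA0 * (uCorr p σ - kappa * uCorr p (sigmaOne σ)) - 0.321 * Real.log p ≤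
      max (A * ((rsA2 + rsA4 - rsA0) / ((p : ℝ) - 1) + 0.44723 * (rsA2 + rsA4 + rsA0) / ((p : ℝ) * s - 1)
        - 0.321)) 0 := by
  have hp1 : (1 : ℝ) < p := by exact_mod_cast hp
  have hlog0 : 0 ≤ Real.log p := Real.log_nonneg hp1.le
  have hU := uCorr_le_of_one_le hp hσ.le
  have hU1 := uCorr_sigmaOne_le hp hσ.le
  have hU0 : 0 ≤ uCorr p σ := uCorr_nonneg hp (by linarith)
  have hU10 : 0 ≤ uCorr p (sigmaOne σ) := uCorr_nonneg hp (by linarith [one_lt_sigmaOne hσ.le])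
  have hden : (p : ℝ) * s - 1 ≤ (p : ℝ) * Real.sqrt p - 1 := by nlinarith
  have h2 : uCorr p (sigmaOne σ) ≤ Real.log p / ((p : ℝ) * s - 1) :=
    hU1.trans (div_le_div_of_nonneg_left hlog0 (by linarith) hden)
  have hk := kappa_lt
  have hk0 := kappa_pos
  set B : ℝ := (rsA2 + rsA4 - rsA0) / ((p : ℝ) - 1) + 0.44723 * (rsA2 + rsA4 + rsA0) / ((p : ℝ) * s - 1)
    - 0.321 with hB
  -- `q ≤ log p · B`
  have hc1 : (0 : ℝ) ≤ rsA2 + rsA4 - rsA0 := by norm_num [rsA2, rsA4, rsA0]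
  have hc2 : (0 : ℝ) ≤ rsA2 + rsA4 + rsA0 := by norm_num [rsA2, rsA4, rsA0]
  have hq : (rsA2 + rsA4) * (uCorr p σ + kappa * uCorr p (sigmaOne σ))
      - rsA0 * (uCorr p σ - kappa * uCorr p (sigmaOne σ)) - 0.321 * Real.log p ≤ Real.log p * B := by
    have e : (rsA2 + rsA4) * (uCorr p σ + kappa * uCorr p (sigmaOne σ))
        - rsA0 * (uCorr p σ - kappa * uCorr p (sigmaOne σ)) - 0.321 * Real.log p =
        (rsA2 + rsA4 - rsA0) * uCorr p σ + (rsA2 + rsA4 + rsA0) * (kappa * uCorr p (sigmaOne σ))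
          - 0.321 * Real.log p := by ring
    have e' : Real.log p * B = (rsA2 + rsA4 - rsA0) * (Real.log p / ((p : ℝ) - 1))
        + (rsA2 + rsA4 + rsA0) * (0.44723 * (Real.log p / ((p : ℝ) * s - 1))) - 0.321 * Real.log p := by
      rw [hB]; ring
    rw [e, e']
    have h3 : kappa * uCorr p (sigmaOne σ) ≤ 0.44723 * (Real.log p / ((p : ℝ) * s - 1)) := by
      calc kappa * uCorr p (sigmaOne σ) ≤ kappa * (Real.log p / ((p : ℝ) * s - 1)) :=
            mul_le_mul_of_nonneg_left h2 hk0.le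
        _ ≤ 0.44723 * (Real.log p / ((p : ℝ) * s - 1)) :=
            mul_le_mul_of_nonneg_right hk.le (hU10.trans h2)
    have h4 := mul_le_mul_of_nonneg_left hU hc1
    have h5 := mul_le_mul_of_nonneg_left h3 hc2
    linarith
  refine hq.trans ?_
  by_cases hB0 : 0 ≤ B
  · exact (mul_le_mul_of_nonneg_right hA hB0).trans (le_max_left _ _)
  · push Not at hB0
    exact (mul_nonpos_iff.2 (Or.inl ⟨hlog0, hB0.le⟩)).trans (le_max_right _ _)

/-- **(38), the per-prime terms**: `≤ 4.86, 3.26, 1.78, 1.08, 0.31, 0.094` for `p = 2, 3, 5, 7, 11, 13`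
and `≤ 0` for primes `p ≥ 17` (McCurley: negative for `p > 11`). [cite: McCurley1984ZFR, §5 (38)] -/
theorem orderTwoPen_le {p : ℕ} (hp : p.Prime) {σ : ℝ} (hσ : 1 < σ) :
    (rsA2 + rsA4) * (uCorr p σ + kappa * uCorr p (sigmaOne σ))
        - rsA0 * (uCorr p σ - kappa * uCorr p (sigmaOne σ)) - 0.321 * Real.log p ≤
      if p = 2 then 4.86 else if p = 3 then 3.26 else if p = 5 then 1.78 else if p = 7 then 1.08
        else if p = 11 then 0.31 else if p = 13 then 0.094 else 0 := by
  obtain ⟨hs2, hs3, hs5, hs7, hs11, hs13, hs17⟩ := sqrt_lower_bounds''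
  obtain ⟨hl7, hl11, hl13⟩ := log_bounds_7_11_13
  have hp2 := hp.two_le
  by_cases h2 : p = 2
  · subst h2; simp only [if_true]
    refine (orderTwoPen_le_of le_rfl hσ (A := 0.6931471808) (s := 1.41421)
      (by exact_mod_cast Real.log_two_lt_d9.le) (by exact_mod_cast hs2.le) (by norm_num)).trans ?_
    refine max_le ?_ (by norm_num)
    norm_num [rsA0, rsA2, rsA4]
  by_cases h3 : p = 3
  · subst h3; simp only [if_true, show (3:ℕ) ≠ 2 by decide, if_false]
    refine (orderTwoPen_le_of (by norm_num) hσ (A := 1.0986124) (s := 1.73205)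
      (by exact_mod_cast log_three_le'') (by exact_mod_cast hs3.le) (by norm_num)).trans ?_
    refine max_le ?_ (by norm_num)
    norm_num [rsA0, rsA2, rsA4]
  by_cases h5 : p = 5
  · subst h5; simp only [if_true, show (5:ℕ) ≠ 2 by decide, show (5:ℕ) ≠ 3 by decide, if_false]
    refine (orderTwoPen_le_of (by norm_num) hσ (A := 1.609438) (s := 2.236)
      (by exact_mod_cast log_five_le') (by exact_mod_cast hs5.le) (by norm_num)).trans ?_
    refine max_le ?_ (by norm_num)
    norm_num [rsA0, rsA2, rsA4]
  by_cases h7 : p = 7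
  · subst h7
    simp only [if_true, show (7:ℕ) ≠ 2 by decide, show (7:ℕ) ≠ 3 by decide, show (7:ℕ) ≠ 5 by decide,
      if_false]
    refine (orderTwoPen_le_of (by norm_num) hσ (A := 2) (s := 2.6457)
      (by exact_mod_cast hl7) (by exact_mod_cast hs7.le) (by norm_num)).trans ?_
    refine max_le ?_ (by norm_num)
    norm_num [rsA0, rsA2, rsA4]
  by_cases h11 : p = 11
  · subst h11
    simp only [if_true, show (11:ℕ) ≠ 2 by decide, show (11:ℕ) ≠ 3 by decide, show (11:ℕ) ≠ 5 by decide,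
      show (11:ℕ) ≠ 7 by decide, if_false]
    refine (orderTwoPen_le_of (by norm_num) hσ (A := 2.4) (s := 3.3166)
      (by exact_mod_cast hl11) (by exact_mod_cast hs11.le) (by norm_num)).trans ?_
    refine max_le ?_ (by norm_num)
    norm_num [rsA0, rsA2, rsA4]
  by_cases h13 : p = 13
  · subst h13
    simp only [if_true, show (13:ℕ) ≠ 2 by decide, show (13:ℕ) ≠ 3 by decide, show (13:ℕ) ≠ 5 by decide,
      show (13:ℕ) ≠ 7 by decide, show (13:ℕ) ≠ 11 by decide, if_false]
    refine (orderTwoPen_le_of (by norm_num) hσ (A := 2.6) (s := 3.6055)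
      (by exact_mod_cast hl13) (by exact_mod_cast hs13.le) (by norm_num)).trans ?_
    refine max_le ?_ (by norm_num)
    norm_num [rsA0, rsA2, rsA4]
  rw [if_neg h2, if_neg h3, if_neg h5, if_neg h7, if_neg h11, if_neg h13]
  -- `p ≥ 17`
  have h17 : 17 ≤ p := by
    by_contra hlt
    have hlt' : p < 17 := not_le.1 hlt
    interval_cases p
    all_goals first | omega | exact absurd hp (by decide)
  have hp17 : (17 : ℝ) ≤ p := by exact_mod_cast h17
  have hsp : (4.1231 : ℝ) ≤ Real.sqrt p := hs17.le.trans (Real.sqrt_le_sqrt hp17)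
  refine (orderTwoPen_le_of hp2 hσ (A := Real.log p) (s := 4.1231) le_rfl hsp (by nlinarith)).trans ?_
  refine max_le ?_ le_rfl
  have hlog0 : 0 ≤ Real.log p := Real.log_nonneg (by linarith)
  refine mul_nonpos_iff.2 (Or.inl ⟨hlog0, ?_⟩)
  have hc1 : (0 : ℝ) ≤ rsA2 + rsA4 - rsA0 := by norm_num [rsA2, rsA4, rsA0]
  have hc2 : (0 : ℝ) ≤ 0.44723 * (rsA2 + rsA4 + rsA0) := by norm_num [rsA2, rsA4, rsA0]
  have h1 : (rsA2 + rsA4 - rsA0) / ((p : ℝ) - 1) ≤ (rsA2 + rsA4 - rsA0) / 16 :=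
    div_le_div_of_nonneg_left hc1 (by norm_num) (by linarith)
  have h3' : 0.44723 * (rsA2 + rsA4 + rsA0) / ((p : ℝ) * 4.1231 - 1) ≤
      0.44723 * (rsA2 + rsA4 + rsA0) / (17 * 4.1231 - 1) :=
    div_le_div_of_nonneg_left hc2 (by norm_num) (by nlinarith)
  have hnum : (rsA2 + rsA4 - rsA0) / 16 + 0.44723 * (rsA2 + rsA4 + rsA0) / (17 * 4.1231 - 1) - 0.321 ≤ 0 := by
    norm_num [rsA2, rsA4, rsA0]
  linarith

/-- **(38), summed**: `Σ_{p∣k} {(a₂+a₄)[U + κU₁] − a₀[U − κU₁] − 0.321 log p} ≤ 11.4` for every `k`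
and `σ > 1`. [cite: McCurley1984ZFR, §5 (38)] -/
theorem sum_orderTwoPen_le (k : ℕ) {σ : ℝ} (hσ : 1 < σ) :
    ∑ p ∈ k.primeFactors, ((rsA2 + rsA4) * (uCorr p σ + kappa * uCorr p (sigmaOne σ))
        - rsA0 * (uCorr p σ - kappa * uCorr p (sigmaOne σ)) - 0.321 * Real.log p) ≤ 11.4 := by
  classical
  set b : ℕ → ℝ := fun p ↦ if p = 2 then 4.86 else if p = 3 then 3.26 else if p = 5 then 1.78
    else if p = 7 then 1.08 else if p = 11 then 0.31 else if p = 13 then 0.094 else 0 with hbdef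
  have hb0 : ∀ p, 0 ≤ b p := by
    intro p; simp only [hbdef]; split_ifs <;> norm_num
  have hle : ∀ p ∈ k.primeFactors, (rsA2 + rsA4) * (uCorr p σ + kappa * uCorr p (sigmaOne σ))
      - rsA0 * (uCorr p σ - kappa * uCorr p (sigmaOne σ)) - 0.321 * Real.log p ≤ b p :=
    fun p hp ↦ orderTwoPen_le (Nat.prime_of_mem_primeFactors hp) hσ
  set S : Finset ℕ := {2, 3, 5, 7, 11, 13} with hS
  have hsub : ∑ p ∈ k.primeFactors, b p ≤ ∑ p ∈ S, b p := by
    have hsplit : ∑ p ∈ k.primeFactors, b p = ∑ p ∈ k.primeFactors.filter (fun p ↦ p ∈ S), b p := by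
      rw [Finset.sum_filter]
      refine Finset.sum_congr rfl fun p _ ↦ ?_
      by_cases h : p ∈ S
      · rw [if_pos h]
      · rw [if_neg h]
        simp only [hS, Finset.mem_insert, Finset.mem_singleton, not_or] at h
        simp [hbdef, h.1, h.2.1, h.2.2.1, h.2.2.2.1, h.2.2.2.2.1, h.2.2.2.2.2]
    rw [hsplit]
    exact Finset.sum_le_sum_of_subset_of_nonneg (fun p hp ↦ (Finset.mem_filter.1 hp).2)
      fun p _ _ ↦ hb0 p
  have hval : ∑ p ∈ S, b p ≤ 11.4 := by
    simp [hS, hbdef]; norm_num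
  calc _ ≤ ∑ p ∈ k.primeFactors, b p := Finset.sum_le_sum hle
    _ ≤ 11.4 := hsub.trans hval

/-- `Σ_{p∣k} log p ≤ log k` (`k ≠ 0`). [folklore] -/
private theorem sum_log_primeFactors_le {k : ℕ} (hk : k ≠ 0) :
    ∑ p ∈ k.primeFactors, Real.log p ≤ Real.log k := by
  have hdvd := Nat.prod_primeFactors_dvd k
  have hle : ((∏ p ∈ k.primeFactors, p : ℕ) : ℝ) ≤ k := by exact_mod_cast Nat.le_of_dvd (Nat.pos_of_ne_zero hk) hdvd
  have hpos : (0 : ℝ) < ((∏ p ∈ k.primeFactors, p : ℕ) : ℝ) := by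
    rw [Nat.cast_prod]
    exact Finset.prod_pos fun p hp ↦ by exact_mod_cast (Nat.prime_of_mem_primeFactors hp).pos
  rw [← Real.log_prod (fun p hp ↦ by exact_mod_cast (Nat.prime_of_mem_primeFactors hp).ne_zero),
    ← Nat.cast_prod]
  exact Real.log_le_log hpos hle

section ClauseTwo

variable {k : ℕ} [NeZero k] {χ : DirichletCharacter ℂ k}

/-- **McCurley's Theorem 1, §5 clause for real characters.** Let `χ` be a primitive character mod `k`
with `χ² = χ₀`, `χ ≠ χ₀`, `L ≥ log k`, `L ≥ log 10`, and `ρ = β + iγ` a zero of `L(s, χ)` with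
`0.538 ≤ |γ|·L` and `|γ| ≤ 1`. Then `β < 1 − 1/(R L)`, `R = 9.645908801` ((38): `χ³ = χ` primitive,
`χ² = χ⁴ = χ₀` with pole terms `a₂(σ−1)/((σ−1)²+4γ²) + a₄(σ−1)/((σ−1)²+16γ²) ≤ [(a₂+a₄)K − 0.321] log M`,
and `0.321 log M ≥ 0.321 Σ_{p∣k} log p` absorbs the principal corrections for `p ≥ 17`).
[cite: McCurley1984ZFR, §5 (38) and Theorem 1] -/
theorem order_two_mid_height (hχ : χ.IsPrimitive) (h1 : χ ≠ 1) (h2 : χ ^ 2 = 1) {L : ℝ}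
    (hLk : Real.log k ≤ L) (hL10 : Real.log 10 ≤ L) {ρ : ℂ} (hz : χ.LFunction ρ = 0)
    (hγlo : 0.538 ≤ |ρ.im| * L) (hγ : |ρ.im| ≤ 1) :
    ρ.re < 1 - 1 / (9.645908801 * L) := by
  by_contra hcon
  have hβw := not_lt.1 hcon
  obtain ⟨hL0, hL, hσ, hσ', hβ0, hβh, hβ', hσm1⟩ := setup' hL10 hβw
  set σ := 1 + rOpt / L with hσdef
  have hr : (0 : ℝ) < rOpt := by norm_num [rOpt]
  -- the powers: `χ³ = χ`, `χ⁴ = χ₀`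
  have h3 : χ ^ 3 = χ := by rw [pow_succ, h2, one_mul]
  have h4 : χ ^ 4 = 1 := by rw [show 4 = 2 * 2 by norm_num, pow_mul, h2, one_pow]
  have hP := rosser_positivity_complex χ hσ ρ.im
  rw [h2, h3, h4] at hP
  have hζ := fdiff_principal_le_sharp115 (k := k) hσ hσ'
  have hm1 := DirichletTheta.fAt_le_of_zero_im hχ h1 hσ.le hz hβ0 hβh
  have hm2 := fAt_principal_le_height_two k hσ hσ' (t := 2 * ρ.im) (by rw [abs_mul, abs_two]; linarith)
  have hm3 := DirichletTheta.fAt_le hχ h1 hσ.le (3 * ρ.im)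
  have hm4 := fAt_principal_le_height_four k hσ hσ' (t := 4 * ρ.im)
    (by rw [abs_mul, abs_of_pos (by norm_num : (0:ℝ) < 4)]; linarith)
  have hΓ1 := gammaDiff_le_height_one (charParity_le_one χ) hσ hσ' hγ
  have hΓ3 := gammaDiff_le_height_three (charParity_le_one χ) hσ hσ' (t := 3 * ρ.im)
    (by rw [abs_mul, abs_of_pos (by norm_num : (0:ℝ) < 3)]; linarith)
  -- the pole terms
  have hpole2 := pole_le (m := 2) hL0 hr (by norm_num : (0:ℝ) < 0.538) hγlo
  have hpole4 := pole_le (m := 4) hL0 hr (by norm_num : (0:ℝ) < 0.538) hγlo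
  rw [← hσm1] at hpole2 hpole4
  have hpc : rsA2 * (rOpt / (rOpt ^ 2 + 2 ^ 2 * 0.538 ^ 2)) + rsA4 * (rOpt / (rOpt ^ 2 + 4 ^ 2 * 0.538 ^ 2))
      ≤ (rsA2 + rsA4) * bigK - 0.321 := by
    have hK := bigK_gt; norm_num [rOpt, rsA2, rsA4] at hK ⊢; linarith
  have a2 : (0 : ℝ) ≤ rsA2 := by norm_num [rsA2]
  have a4 : (0 : ℝ) ≤ rsA4 := by norm_num [rsA4]
  have hpoles : rsA2 * ((σ - 1) / ((σ - 1) ^ 2 + (2 * ρ.im) ^ 2))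
      + rsA4 * ((σ - 1) / ((σ - 1) ^ 2 + (4 * ρ.im) ^ 2)) ≤ ((rsA2 + rsA4) * bigK - 0.321) * L := by
    have e2 := mul_le_mul_of_nonneg_left hpole2 a2
    have e4 := mul_le_mul_of_nonneg_left hpole4 a4
    have := mul_le_mul_of_nonneg_right hpc hL0.le
    nlinarith
  -- `0.321 L ≥ 0.321 Σ_{p∣k} log p`
  have hlogk : ∑ p ∈ k.primeFactors, Real.log p ≤ L :=
    (sum_log_primeFactors_le (NeZero.ne k)).trans hLk
  -- the corrections
  have hpen := sum_orderTwoPen_le k hσ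
  rw [Finset.sum_sub_distrib, Finset.sum_sub_distrib, ← Finset.mul_sum, ← Finset.mul_sum,
    ← Finset.mul_sum] at hpen
  have hKpos := bigK_pos
  have hKL : bigK * Real.log k ≤ bigK * L := mul_le_mul_of_nonneg_left hLk hKpos.le
  have a0 : (0 : ℝ) ≤ rsA0 := by norm_num [rsA0]
  have a1 : (0 : ℝ) ≤ rsA1 := by norm_num [rsA1]
  have a3 : (0 : ℝ) ≤ rsA3 := by norm_num [rsA3]
  have e0 := mul_le_mul_of_nonneg_left hζ a0
  have e1 := mul_le_mul_of_nonneg_left (show fAt χ σ ρ.im ≤ bigK * L - 0.237 - 1 / (σ - ρ.re) by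
    linarith) a1
  have e2 := mul_le_mul_of_nonneg_left hm2 a2
  have e3 := mul_le_mul_of_nonneg_left (show fAt χ σ (3 * ρ.im) ≤ bigK * L + 0.141 by linarith) a3
  have e4 := mul_le_mul_of_nonneg_left hm4 a4
  have hc : -(0.80 : ℝ) * rsA0 - 0.237 * rsA1 - 0.136 * rsA2 + 0.141 * rsA3 + 0.053 * rsA4 + 11.4 ≤ -2.9 := by
    norm_num [rsA0, rsA1, rsA2, rsA3, rsA4]
  have key : rsA1 * (1 / (σ - ρ.re)) ≤ rsA0 * (1 / (σ - 1))
      + bigK * (rsA1 + rsA2 + rsA3 + rsA4) * L - 2.9 := by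
    linarith [e0, e1, e2, e3, e4, hP, hpoles, hpen, hlogk, hc]
  have hm : rsA1 / (σ - ρ.re) ≤ rsA0 / (σ - 1) + bigK * (rsA1 + rsA2 + rsA3 + rsA4) * L - 2.9 := by
    simpa only [mul_one_div] using key
  have hβ1 : ρ.re < 1 := by
    by_contra hb
    exact LFunction_ne_zero_of_one_le_re χ (Or.inl h1) (not_lt.1 hb) hz
  have hc1 : (0 : ℝ) < rsA1 := by norm_num [rsA1]
  refine endgame_contra (K' := bigK * (rsA1 + rsA2 + rsA3 + rsA4)) (C := -2.9) hL0 hr (by norm_num) hc1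
    (by norm_num) hβ' (by linarith) ?_ numeric_generic
  linarith

end ClauseTwo

/-! ## §5: quartic characters in the range `|γ| log M ≤ 0.264` ((43)–(45)) -/

section Intermediate

open LSeries ArithmeticFunction

variable {k : ℕ} [NeZero k]

omit [NeZero k] in
/-- For a unit `n` mod `k`: `χᵐ(n) n^{−imt} = (χ(n) n^{−it})ᵐ`. [folklore] -/
private theorem twist_pow_eq' (χ : DirichletCharacter ℂ k) (t : ℝ) (n m : ℕ) (u : (ZMod k)ˣ)
    (hu : (u : ZMod k) = n) :
    (χ ^ m) (n : ZMod k) * (n : ℂ) ^ (-((((m : ℝ) * t : ℝ) : ℂ) * I)) =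
      (χ (n : ZMod k) * (n : ℂ) ^ (-(t * I))) ^ m := by
  rw [← hu, MulChar.pow_apply_coe, mul_pow, ← Complex.cpow_nat_mul]
  congr 2
  push_cast
  ring

/-- The weighted Dirichlet series of one index: `c·f(mt, χᵐ) = Σₙ c·Λ(n)(n^{−σ} − κn^{−σ₁}) Re(χᵐ(n)n^{−imt})`.
[cite: McCurley1984ZFR, §4 (27)] -/
private theorem hasSum_index (χ : DirichletCharacter ℂ k) {σ : ℝ} (hσ : 1 < σ) (t c : ℝ) (m : ℕ) :
    HasSum (fun n : ℕ ↦
      c * ((Λ n : ℝ) / (n : ℝ) ^ σ * ((χ ^ m) (n : ZMod k) * (n : ℂ) ^ (-((((m : ℝ) * t : ℝ) : ℂ) * I))).re)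
      - c * (kappa * ((Λ n : ℝ) / (n : ℝ) ^ sigmaOne σ *
        ((χ ^ m) (n : ZMod k) * (n : ℂ) ^ (-((((m : ℝ) * t : ℝ) : ℂ) * I))).re)))
      (c * fAt (χ ^ m) σ ((m : ℝ) * t)) := by
  have hσ₁ : 1 < sigmaOne σ := one_lt_sigmaOne hσ.le
  have h := ((hasSum_re_twist_complex (χ ^ m) hσ ((m : ℝ) * t)).mul_left c).sub
    (((hasSum_re_twist_complex (χ ^ m) hσ₁ ((m : ℝ) * t)).mul_left kappa).mul_left c)
  unfold fAt
  rw [mul_sub]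
  exact h

/-- **Positivity at complex points for a cubic trigonometric polynomial.** If
`c₀ + c₁cos θ + c₂cos 2θ + c₃cos 3θ ≥ 0` for all `θ` (stated through `x = cos θ ∈ [−1,1]`), then for
every character `χ` mod `k`, `σ > 1`, real `t`:
`0 ≤ c₀ f_{χ₀}(σ) + c₁ f(t,χ) + c₂ f(2t,χ²) + c₃ f(3t,χ³)`. [cite: McCurley1984ZFR, §5 (43)–(44)] -/
theorem positivity_complex_poly3 (c₀ c₁ c₂ c₃ : ℝ)
    (hP : ∀ x : ℝ, -1 ≤ x → x ≤ 1 → 0 ≤ c₀ + c₁ * x + c₂ * (2 * x ^ 2 - 1) + c₃ * (4 * x ^ 3 - 3 * x))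
    (χ : DirichletCharacter ℂ k) {σ : ℝ} (hσ : 1 < σ) (t : ℝ) :
    0 ≤ c₀ * fdiff (1 : DirichletCharacter ℂ k) σ + c₁ * fAt χ σ t
      + c₂ * fAt (χ ^ 2) σ (2 * t) + c₃ * fAt (χ ^ 3) σ (3 * t) := by
  have hσσ₁ : σ ≤ sigmaOne σ := (lt_sigmaOne (show (0 : ℝ) < σ by linarith)).le
  have hS := (((hasSum_index χ hσ t c₀ 0).add (hasSum_index χ hσ t c₁ 1)).add
    (hasSum_index χ hσ t c₂ 2)).add (hasSum_index χ hσ t c₃ 3)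
  have e0 : c₀ * fAt (χ ^ 0) σ (((0 : ℕ) : ℝ) * t) = c₀ * fdiff (1 : DirichletCharacter ℂ k) σ := by
    rw [pow_zero, Nat.cast_zero, zero_mul, fAt_zero]
  have e1 : c₁ * fAt (χ ^ 1) σ (((1 : ℕ) : ℝ) * t) = c₁ * fAt χ σ t := by
    rw [pow_one, Nat.cast_one, one_mul]
  have e2 : c₂ * fAt (χ ^ 2) σ (((2 : ℕ) : ℝ) * t) = c₂ * fAt (χ ^ 2) σ (2 * t) := by
    rw [Nat.cast_ofNat]
  have e3 : c₃ * fAt (χ ^ 3) σ (((3 : ℕ) : ℝ) * t) = c₃ * fAt (χ ^ 3) σ (3 * t) := by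
    rw [Nat.cast_ofNat]
  rw [e0, e1, e2, e3] at hS
  refine hS.nonneg fun n ↦ ?_
  rcases Nat.eq_zero_or_pos n with rfl | hn
  · simp
  set a := (Λ n : ℝ) with hadef
  set u := (n : ℝ) ^ σ with hudef
  set v := (n : ℝ) ^ sigmaOne σ with hvdef
  have ha : 0 ≤ a := vonMangoldt_nonneg
  have hw : 0 ≤ 1 / u - kappa * (1 / v) := by
    have hn1 : (1 : ℝ) ≤ n := by exact_mod_cast hn
    have hupos : 0 < u := Real.rpow_pos_of_pos (by linarith) _
    have huv : u ≤ v := Real.rpow_le_rpow_of_exponent_le hn1 hσσ₁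
    have h1 : 1 / v ≤ 1 / u := one_div_le_one_div_of_le hupos huv
    have h2 : 0 ≤ 1 / v := by positivity
    nlinarith [kappa_lt_one, kappa_pos]
  set x0 := ((χ ^ 0) (n : ZMod k) * (n : ℂ) ^ (-(((((0 : ℕ) : ℝ) * t : ℝ) : ℂ) * I))).re with hx0
  set x1 := ((χ ^ 1) (n : ZMod k) * (n : ℂ) ^ (-(((((1 : ℕ) : ℝ) * t : ℝ) : ℂ) * I))).re with hx1
  set x2 := ((χ ^ 2) (n : ZMod k) * (n : ℂ) ^ (-(((((2 : ℕ) : ℝ) * t : ℝ) : ℂ) * I))).re with hx2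
  set x3 := ((χ ^ 3) (n : ZMod k) * (n : ℂ) ^ (-(((((3 : ℕ) : ℝ) * t : ℝ) : ℂ) * I))).re with hx3
  -- `0 ≤ c₀x₀ + c₁x₁ + c₂x₂ + c₃x₃`
  have hPn : 0 ≤ c₀ * x0 + c₁ * x1 + c₂ * x2 + c₃ * x3 := by
    by_cases hun : IsUnit (n : ZMod k)
    · obtain ⟨w, hw'⟩ := hun
      rw [hx0, hx1, hx2, hx3, twist_pow_eq' χ t n 0 w hw', twist_pow_eq' χ t n 1 w hw',
        twist_pow_eq' χ t n 2 w hw', twist_pow_eq' χ t n 3 w hw']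
      set z := χ (n : ZMod k) * (n : ℂ) ^ (-(t * I)) with hz
      have hzn : ‖z‖ = 1 := by
        rw [hz, norm_mul, ← hw', χ.unit_norm_eq_one w, one_mul, Complex.norm_natCast_cpow_of_pos hn]
        simp
      have h : z.re ^ 2 + z.im ^ 2 = 1 := by
        have := Complex.normSq_apply z
        rw [Complex.normSq_eq_norm_sq, hzn] at this
        nlinarith [this]
      have hre1 : z.re ≤ 1 := by nlinarith [sq_nonneg z.im, sq_nonneg (z.re - 1)]
      have hre2 : -1 ≤ z.re := by nlinarith [sq_nonneg z.im, sq_nonneg (z.re + 1)]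
      rw [pow_zero, Complex.one_re, pow_one, re_pow_two_of_unit h, re_pow_three_of_unit h, mul_one]
      exact hP z.re hre2 hre1
    · rw [hx0, hx1, hx2, hx3]
      simp only [MulChar.map_nonunit _ hun, zero_mul, Complex.zero_re, mul_zero, add_zero, le_refl]
  have key : 0 ≤ a * (1 / u - kappa * (1 / v)) * (c₀ * x0 + c₁ * x1 + c₂ * x2 + c₃ * x3) :=
    mul_nonneg (mul_nonneg ha hw) hPn
  have e : a * (1 / u - kappa * (1 / v)) * (c₀ * x0 + c₁ * x1 + c₂ * x2 + c₃ * x3)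
      = (c₀ * (a / u * x0) - c₀ * (kappa * (a / v * x0)))
        + (c₁ * (a / u * x1) - c₁ * (kappa * (a / v * x1)))
        + (c₂ * (a / u * x2) - c₂ * (kappa * (a / v * x2)))
        + (c₃ * (a / u * x3) - c₃ * (kappa * (a / v * x3))) := by ring
  linarith [key, e]

/-- **The kept zero at a shifted height** ("as in (21)"): for `σ ≥ 1`, a point `ρ' = β' + iγ'` with
`0 < β' ≤ 1`, and any real `t`:
`F(σ+it, ρ') − κF(σ₁+it, ρ') ≥ (σ−β')/((σ−β')² + (t−γ')²) − 1`
(`κ[1/(σ₁−β') + 1/(σ₁−1+β')] = κ(2σ₁−1)/((σ₁−β')(σ₁−1+β')) ≤ σ/σ² ≤ 1`). [cite: McCurley1984ZFR, §5 (45) and (21)] -/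
theorem stF_diff_ge {σ : ℝ} (hσ : 1 ≤ σ) {ρ' : ℂ} (h0 : 0 < ρ'.re) (h1 : ρ'.re ≤ 1) (t : ℝ) :
    (σ - ρ'.re) / ((σ - ρ'.re) ^ 2 + (t - ρ'.im) ^ 2) - 1 ≤
      stF (σ + t * I) ρ' - kappa * stF (sigmaOne σ + t * I) ρ' := by
  rw [stF_eq, stF_eq]
  have hσ₁ := sigmaOne_gt_1618 hσ
  set x := sigmaOne σ - ρ'.re with hx
  set y := sigmaOne σ - 1 + ρ'.re with hy
  have hx0 : 0 < x := by rw [hx]; linarith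
  have hy0 : 0 < y := by rw [hy]; linarith
  have hsec : 0 ≤ (σ - 1 + ρ'.re) / ((σ - 1 + ρ'.re) ^ 2 + (t - ρ'.im) ^ 2) :=
    div_nonneg (by linarith) (by positivity)
  have hF1 : x / (x ^ 2 + (t - ρ'.im) ^ 2) ≤ 1 / x := by
    rw [div_le_div_iff₀ (by positivity) hx0]; nlinarith [sq_nonneg (t - ρ'.im)]
  have hF2 : y / (y ^ 2 + (t - ρ'.im) ^ 2) ≤ 1 / y := by
    rw [div_le_div_iff₀ (by positivity) hy0]; nlinarith [sq_nonneg (t - ρ'.im)]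
  have hk := kappa_pos
  -- `κ(1/x + 1/y) ≤ 1`
  have hxy : σ ^ 2 ≤ x * y := by
    have := sigmaOne_sq σ
    rw [hx, hy]; nlinarith
  have hsum : kappa * (x + y) ≤ σ := by
    have := kappa_mul_le_self hσ; rw [hx, hy]; linarith
  have hone : kappa * (1 / x + 1 / y) ≤ 1 := by
    rw [div_add_div _ _ hx0.ne' hy0.ne', ← mul_div_assoc, div_le_one (by positivity)]
    nlinarith
  have := mul_le_mul_of_nonneg_left (add_le_add hF1 hF2) hk.le
  linarith

/-- **The endgame of (43)–(45).** With `v = σ − β ∈ (0, (0.345 + 1/R)/L]` and `|γ|·L ≤ 0.264`: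
`8/v + v/(v² + 16γ²) ≥ 18.17·L` (the left side is decreasing in `v` and in `|γ|`).
[cite: McCurley1984ZFR, §5 (after (45)): "the left side is decreasing in b provided c < 0.264"] -/
theorem endgame_intermediate {L v γ : ℝ} (hL : 0 < L) (hv0 : 0 < v)
    (hv : v * L ≤ 0.345 + 1 / 9.645908801) (hγ : |γ| * L ≤ 0.264) :
    18.17 * L ≤ 8 / v + v / (v ^ 2 + 16 * γ ^ 2) := by
  set u := v * L with hu
  set u₀ : ℝ := 0.345 + 1 / 9.645908801 with hu₀
  set D : ℝ := 1.115136 with hD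
  have hu0 : 0 < u := by positivity
  -- `16γ² ≤ D/L²`
  have hγ2 : 16 * γ ^ 2 ≤ D / L ^ 2 := by
    rw [le_div_iff₀ (by positivity), hD]
    have h1 : (|γ| * L) ^ 2 ≤ 0.264 ^ 2 := pow_le_pow_left₀ (by positivity) hγ 2
    rw [mul_pow, sq_abs] at h1
    nlinarith
  have hstep1 : v / (v ^ 2 + D / L ^ 2) ≤ v / (v ^ 2 + 16 * γ ^ 2) :=
    div_le_div_of_nonneg_left hv0.le (by positivity) (by linarith)
  -- scaling: `8/v + v/(v² + D/L²) = L·(8/u + u/(u² + D))`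
  have hv' : v = u / L := by rw [hu]; field_simp
  have hD0 : 0 < D := by rw [hD]; norm_num
  have hscale : 8 / v + v / (v ^ 2 + D / L ^ 2) = L * (8 / u + u / (u ^ 2 + D)) := by
    rw [hv']
    field_simp
  -- monotonicity in `u`
  have hle : u ≤ u₀ := hv
  have hu₀0 : 0 < u₀ := by rw [hu₀]; norm_num
  have hmono : 8 / u₀ + u₀ / (u₀ ^ 2 + D) ≤ 8 / u + u / (u ^ 2 + D) := by
    have hid : 8 / u + u / (u ^ 2 + D) - (8 / u₀ + u₀ / (u₀ ^ 2 + D)) =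
        (u₀ - u) * (8 / (u * u₀) - (D - u * u₀) / ((u ^ 2 + D) * (u₀ ^ 2 + D))) := by
      field_simp
      ring
    have h1 : 8 / (u₀ * u₀) ≤ 8 / (u * u₀) :=
      div_le_div_of_nonneg_left (by norm_num) (by positivity) (by nlinarith)
    have h2 : (D - u * u₀) / ((u ^ 2 + D) * (u₀ ^ 2 + D)) ≤ 1 / D := by
      rw [div_le_div_iff₀ (by positivity) hD0]
      nlinarith [mul_nonneg (sq_nonneg u) (sq_nonneg u₀), mul_nonneg (sq_nonneg u) hD0.le,
        mul_nonneg (sq_nonneg u₀) hD0.le, mul_nonneg hu0.le hu₀0.le]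
    have h3 : (0 : ℝ) ≤ 8 / (u₀ * u₀) - 1 / D := by rw [hu₀, hD]; norm_num
    have h4 : 0 ≤ u₀ - u := by linarith
    rw [← sub_nonneg, hid]
    exact mul_nonneg h4 (by linarith)
  have hval : (18.17 : ℝ) ≤ 8 / u₀ + u₀ / (u₀ ^ 2 + D) := by rw [hu₀, hD]; norm_num
  calc 18.17 * L ≤ L * (8 / u + u / (u ^ 2 + D)) := by nlinarith
    _ = 8 / v + v / (v ^ 2 + D / L ^ 2) := hscale.symm
    _ ≤ 8 / v + v / (v ^ 2 + 16 * γ ^ 2) := by linarith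

variable {χ : DirichletCharacter ℂ k}

/-- **McCurley's Theorem 1 for quartic characters at heights `|γ| log M ≤ 0.264`** (his "intermediate
range" argument (43)–(45), which in fact covers all `|γ| log M ≤ 0.264`). Let `χ` be primitive mod `k`
with `χ⁴ = χ₀`, `χ² ≠ χ₀`, `L ≥ log k`, `L ≥ log 10`, and `ρ = β + iγ` a zero of `L(s,χ)` with
`|γ|·L ≤ 0.264`. Then `β < 1 − 1/(R L)`, `R = 9.645908801`: from
`5f(0,χ₀) + 8f(γ,χ) + 4f(2γ,χ²) + f(3γ,χ̄) ≥ 0` with the zero `ρ̄` of `L(s,χ̄)` kept in `f(3γ,χ̄)`,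
`8/(σ−β) + (σ−β)/((σ−β)²+16γ²) ≤ 5/(σ−1) + 13K log M` (constants: ours `−0.62 ≤ 0`), `σ = 1 + 0.345/log M`.
[cite: McCurley1984ZFR, §5 (43)–(45) and Theorem 1] -/
theorem order_four_low_height (hχ : χ.IsPrimitive) (h2 : χ ^ 2 ≠ 1) (h4 : χ ^ 4 = 1) {L : ℝ}
    (hLk : Real.log k ≤ L) (hL10 : Real.log 10 ≤ L) {ρ : ℂ} (hz : χ.LFunction ρ = 0)
    (hγ : |ρ.im| * L ≤ 0.264) :
    ρ.re < 1 - 1 / (9.645908801 * L) := by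
  by_contra hcon
  have hβw := not_lt.1 hcon
  have h1 : χ ≠ 1 := fun h ↦ h2 (by rw [h, one_pow])
  have hL : 2.30258 ≤ L := log_ten_ge'''.trans hL10
  have hL0 : 0 < L := by linarith
  have hb : 1 - (1 / 9.645908801) / L ≤ ρ.re := by
    have e : 1 / (9.645908801 * L) = (1 / 9.645908801) / L := by rw [div_div]
    rw [← e]; exact hβw
  have hbL : (1 / 9.645908801) / L ≤ 0.0451 := by
    rw [div_le_iff₀ hL0]; norm_num; linarith
  have hβ0 : 0 < ρ.re := by linarith
  have hβh : ρ.re ≠ 1 / 2 := by intro h; rw [h] at hb; linarith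
  have hβ1 : ρ.re < 1 := by
    by_contra hb'
    exact LFunction_ne_zero_of_one_le_re χ (Or.inl h1) (not_lt.1 hb') hz
  set σ : ℝ := 1 + 0.345 / L with hσdef
  have hσ : 1 < σ := by have := div_pos (by norm_num : (0:ℝ) < 0.345) hL0; linarith
  have hσ' : σ ≤ 1.15 := by
    have : 0.345 / L ≤ 0.14984 := by rw [div_le_iff₀ hL0]; norm_num; linarith
    linarith
  have hγ1 : |ρ.im| ≤ 1 := by
    have : |ρ.im| * L ≤ 1 * L := by linarith
    exact le_of_mul_le_mul_right this hL0
  -- the powers: `χ³ = χ⁻¹`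
  have hinv : χ ^ 3 = χ⁻¹ := by
    have : χ ^ 3 * χ = 1 := by rw [← pow_succ]; exact h4
    exact eq_inv_of_mul_eq_one_left this
  -- positivity with (43): `5 + 8x + 4(2x²−1) + (4x³−3x) = (1+x)(1+2x)²`
  have hP := positivity_complex_poly3 5 8 4 1 (fun x hx _ ↦ by
    nlinarith [mul_nonneg (show (0:ℝ) ≤ 1 + x by linarith) (sq_nonneg (1 + 2 * x))]) χ hσ ρ.im
  rw [hinv] at hP
  -- the four indices
  have hζ := fdiff_principal_le_sharp115 (k := k) hσ hσ'
  have hhelp := sum_help_nonneg'' k hσ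
  have hm1 := DirichletTheta.fAt_le_of_zero_im hχ h1 hσ.le hz hβ0 hβh
  have hm2 := fAt_induced_le (χ ^ 2) h2 hσ (2 * ρ.im)
  have hG := sum_max_gPen_le k hσ
  -- `χ̄` with its zero `ρ̄`
  have hz' : χ⁻¹.LFunction (starRingEnd ℂ ρ) = 0 := by
    have h := DirichletZFR.conj_LFunction_conj χ h1 (starRingEnd ℂ ρ)
    rw [Complex.conj_conj, hz, _root_.map_zero] at h
    exact h.symm
  have h0' : 0 < (starRingEnd ℂ ρ).re := by rw [Complex.conj_re]; exact hβ0
  have hhalf' : (starRingEnd ℂ ρ).re ≠ 1 / 2 := by rw [Complex.conj_re]; exact hβh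
  have hm3 := DirichletTheta.fAt_le_of_zero (isPrimitive_inv'' hχ) (inv_ne_one.2 h1) hσ.le (3 * ρ.im)
    hz' h0' hhalf'
  rw [DirichletTheta.charParity_inv] at hm3
  have hS := stF_diff_ge hσ.le h0' (by rw [Complex.conj_re]; exact hβ1.le) (3 * ρ.im)
  rw [Complex.conj_re, Complex.conj_im, show 3 * ρ.im - -ρ.im = 4 * ρ.im by ring] at hS
  -- Gamma terms
  have hΓ1 := gammaDiff_le_height_one (charParity_le_one χ) hσ hσ' hγ1
  have hΓ2 := gammaDiff_le_height_two (charParity_le_one (χ ^ 2)) hσ hσ' (t := 2 * ρ.im)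
    (by rw [abs_mul, abs_two]; linarith)
  have hΓ3 := gammaDiff_le_height_three (charParity_le_one χ) hσ hσ' (t := 3 * ρ.im)
    (by rw [abs_mul, abs_of_pos (by norm_num : (0:ℝ) < 3)]; linarith)
  have hKL : bigK * Real.log k ≤ bigK * L := mul_le_mul_of_nonneg_left hLk bigK_pos.le
  have hK := bigK_lt
  -- the main inequality
  have hmain : 8 / (σ - ρ.re) + (σ - ρ.re) / ((σ - ρ.re) ^ 2 + 16 * ρ.im ^ 2) ≤
      5 / (σ - 1) + 13 * bigK * L := by
    have e16 : (σ - ρ.re) ^ 2 + (4 * ρ.im) ^ 2 = (σ - ρ.re) ^ 2 + 16 * ρ.im ^ 2 := by ring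
    rw [e16] at hS
    have e8 : 8 / (σ - ρ.re) = 8 * (1 / (σ - ρ.re)) := by ring
    have e5 : 5 / (σ - 1) = 5 * (1 / (σ - 1)) := by ring
    rw [e8, e5]
    linarith
  -- the endgame
  have hv0 : 0 < σ - ρ.re := by linarith
  have hv : (σ - ρ.re) * L ≤ 0.345 + 1 / 9.645908801 := by
    have e1 : (σ - ρ.re) * L ≤ (0.345 / L + (1 / 9.645908801) / L) * L := by
      apply mul_le_mul_of_nonneg_right _ hL0.le; rw [hσdef]; linarith
    have e2 : (0.345 / L + (1 / 9.645908801) / L) * L = 0.345 + 1 / 9.645908801 := by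
      field_simp
    linarith
  have hE := endgame_intermediate hL0 hv0 hv hγ
  have hσ1 : σ - 1 = 0.345 / L := by rw [hσdef]; ring
  have hR : 5 / (σ - 1) + 13 * bigK * L < 18.17 * L := by
    rw [hσ1, div_div_eq_mul_div]
    have : 5 * L / 0.345 + 13 * bigK * L = (5 / 0.345 + 13 * bigK) * L := by ring
    rw [this]
    have hc : 5 / 0.345 + 13 * bigK < 18.17 := by norm_num at hK ⊢; linarith
    nlinarith
  linarith

end Intermediate

/-! ## All zeros of height `|γ| ≤ 1` -/

section HeightLeOne

variable {k : ℕ} [NeZero k] {χ : DirichletCharacter ℂ k}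

/-- **McCurley's Theorem 1 for all zeros of height `|γ| ≤ 1`** (§5 and §6 combined with the real-zero
and order-`≥ 5` clauses). Let `χ` be a primitive character mod `k`, `χ ≠ χ₀`, `L ≥ log k`, `L ≥ log 10`,
and `ρ = β + iγ` a zero of `L(s, χ)` with `|γ| ≤ 1`; if `χ` is real assume `γ ≠ 0` (the possible
exceptional real zero). Then `β < 1 − 1/(R L)`, `R = 9.645908801`. (With `L = log max(k, k|γ|, 10) =
log M` for `|γ| ≤ 1` this is Theorem 1 restricted to `|γ| ≤ 1`.)
[cite: McCurley1984ZFR, Theorem 1 with §5–§6] -/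
theorem height_le_one (hχ : χ.IsPrimitive) (h1 : χ ≠ 1) {L : ℝ} (hLk : Real.log k ≤ L)
    (hL10 : Real.log 10 ≤ L) {ρ : ℂ} (hz : χ.LFunction ρ = 0) (hγ : |ρ.im| ≤ 1)
    (hreal : χ ^ 2 = 1 → ρ.im ≠ 0) :
    ρ.re < 1 - 1 / (9.645908801 * L) := by
  by_cases h2 : χ ^ 2 = 1
  · by_cases hs : |ρ.im| * L ≤ 0.538
    · exact order_two_small_height hχ h1 h2 hLk hL10 hz (hreal h2) hs
    · exact order_two_mid_height hχ h1 h2 hLk hL10 hz (not_le.1 hs).le hγ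
  by_cases h3 : χ ^ 3 = 1
  · by_cases hs : |ρ.im| * L ≤ 0.403
    · exact order_three_small_height hχ h1 h3 hLk hL10 hz hs
    · exact order_three_mid_height hχ h1 h3 hLk hL10 hz (not_le.1 hs).le hγ
  by_cases h4 : χ ^ 4 = 1
  · by_cases hs : |ρ.im| * L ≤ 0.264
    · exact order_four_low_height hχ h2 h4 hLk hL10 hz hs
    · exact order_four_mid_height hχ h2 h4 hLk hL10 hz (not_le.1 hs).le hγ
  exact generic_mid_height hχ h2 h3 h4 hLk hL10 hz hγ

end HeightLeOne

end McCurleyStechkin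

end Literature.NumberTheory.LFunctions
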